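import Literature.NumberTheory.LFunctions.SelbergArgOmegaWindow
import Literature.NumberTheory.LFunctions.SelbergArgOmegaOffLine
import Literature.NumberTheory.LFunctions.SelbergArgOmegaPrimeMoments
import Literature.NumberTheory.LFunctions.TsangMomentComparison
import Literature.NumberTheory.LFunctions.MertensConstant
import Literature.NumberTheory.LFunctions.SelbergArgOmega
import HarnessLib

/-!
# Selberg's `Ω`-theorem for `S(t)`: the assembly (conditional on a zero-density estimate)

Last file of the proof programme for the named fact
`Literature.NumberTheory.LFunctions.Selberg1946_zetaArgS_omega` (`SelbergArgOmega.lean`):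

  `S(t) = Ω_±((log t)^{1/3} (log log t)^{-7/3})`   (Selberg 1946; Titchmarsh (9.9.7)).

Following K.-M. Tsang, *Some `Ω`-theorems for the Riemann zeta-function*, Acta Arith. 46 (1986),
§3, the five steps of the programme are put together here:

* `exists_zetaArgS_large_of_WR` (§3, (3.4)–(3.9)) — from a two-sided large value of `W + R` on `[T, 2T]`
  to large values of `±S` on `[T/2, 3T]`, through the convolution identity
  (`exists_smoothS_increment_bound`, step 2), the average of `Φ_S` (`exists_abs_integral_smoothS_le`,
  step 5b) and the kernel-to-supremum passage (`exists_smoothS_sub_near_le`, `near_integral_le`, step 5a);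
* `re_primeV_eq`, `abs_primePowPart_le` — the prime side of the explicit formula is `-2F + O(L²)` with
  `F(t) = Im ∑_{p ≤ e^{L/4}} a_p e^{-it log p}`, `a_p = g_L(log p)/√p ≥ 0`;
* `exists_zetaArgS_large_of_params` — Tsang's Lemma 4 (`Tsang1986_lemma4`) fed with the prime moments
  (`Tsang1986.integral_im_pow_even_ge_of_subset`, `Tsang1986.abs_integral_im_pow_odd_le`, step 4) and the
  off-line moments (`offR_moment_le_of_density`, step 3, which carries the zero-density HYPOTHESIS);
* `Selberg1946_zetaArgS_omega_of_zeroDensity` — the parameter choice `L = 16 log log T`,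
  `k ≍ (log T)^{2/3}/L²`, the loud primes `((log T)^{3/4}, log T]` (Mertens, `MertensConstant.lean`;
  `g₀ ≥ 1/16` on `[-1/16, 1/16]`, `g0_re_ge`), `m = √(kS'/(8e))`, giving the rate
  `(log T)^{1/3}/log log T` on every window `[T, 6T]` and hence the named fact through
  `Selberg1946_zetaArgS_omega_of_local_weak`; `Selberg1946_zetaArgS_omega_of_zeroDensity'` takes the
  density hypothesis in the tree's form (`SelbergApproxFormulaMeanSquare.lean`: `κ > 0`, `T ≥ T₀`).

**Status.** The discharge is CONDITIONAL on an explicit binder: a zero-density estimate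
`N(σ, H) ≤ C_D H^{1 - A(σ - 1/2)} (log H)^B` (`1/2 ≤ σ ≤ 1`, `H ≥ 2`, some `A > 0`, `B, C_D ≥ 0`).
Selberg's density theorem (1946, Thm 1: `A = 1/4`, `B = 1`; Titchmarsh §9.19) is such an estimate; it is
not yet in the tree (Ingham's `zeroDensity_ingham_holds` loses `T^ε`, too much at distance
`O(log log T/log T)` from the line), and by D-0026 it is not vendored here as a named fact. Once it is
proved, `Selberg1946_zetaArgS_omega_holds` is a one-line application of
`Selberg1946_zetaArgS_omega_of_zeroDensity`.

Everything in this file is proved; the definitions (`aCoef`, `primesP`, `primeF`, `primePowPart`) are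
concrete auxiliary objects; no named facts.

## References

* [Tsang1986] K.-M. Tsang, *Some `Ω`-theorems for the Riemann zeta-function*, Acta Arith. 46 (1986)
  369–395, Thm 3, Lemma 4 and §3.
* A. Selberg, *Contributions to the theory of the Riemann zeta-function*, Arch. Math. Naturvid. 48
  (1946), Thm 1.
* E. C. Titchmarsh, *The Theory of the Riemann Zeta-Function*, 2nd ed., §§9.9, 9.19, (9.9.7).
* [HardyWright2008] G. H. Hardy, E. M. Wright, *An Introduction to the Theory of Numbers*, Thm 427.
-/

noncomputable section

open Complex Filter Set MeasureTheory
open scoped Real Topology ComplexConjugate ArithmeticFunction.vonMangoldt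

namespace Literature.NumberTheory.LFunctions

namespace SelbergOmega

open RudnickSarnakN

variable {L : ℝ}


/-! ## F3a: from a two-sided large value of `W + R` on `[T, 2T]` to large values of `±S` on `[T/2, 3T]` -/

section FromWR

/-- `Φ_S` is interval integrable on `[T, 2T]` (`L ≥ 1`, `T ≥ 0`). [folklore] -/
theorem intervalIntegrable_smoothS (hL : 1 ≤ L) {T : ℝ} (hT : 0 ≤ T) :
    IntervalIntegrable (smoothS L) volume T (2 * T) := by
  rw [intervalIntegrable_iff]
  exact (integrable_zetaArgS_kerDil_prod hL hT).integral_prod_left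

/-- **From `W + R` to `S`.** There is an absolute `C` such that for `L ≥ 1`, `T ≥ 4` and any `W, R`
continuous on `[T, 2T]` with `|W + R + Re 𝒱_L + Re ℛ_L| ≤ E₁` there, `|∫_T^{2T} W| ≤ I_W`, `∫_T^{2T} |R| ≤ I_R`:
with `D' := D - 2E₁ - (C L e^{L/8} log(T+2) + I_W + I_R)/T`, a value `W(t₁) + R(t₁) ≥ D` forces
`S(u) ≥ M₀` somewhere on `[T/2, 3T]` whenever `0 ≤ M₀` and `2π g₀(0) M₀ + 1 ≤ D'`, and symmetrically for
`W(t₂) + R(t₂) ≤ -D`. (The convolution identity `exists_smoothS_increment_bound` makes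
`Φ_S = C_T - Re 𝒱_L - Re ℛ_L + O(ε)` on `[T, 2T]`; the constant `C_T` is controlled by averaging over `[T, 2T]`
(`exists_abs_integral_smoothS_le`); and `Φ_S(t) ≤ 2π g₀(0) sup_{[T/2,3T]} S + O(1/T)`
(`exists_smoothS_sub_near_le`, `near_integral_le`).) [cite: Tsang1986, §3, (3.4)–(3.9)] -/
theorem exists_zetaArgS_large_of_WR : ∃ C : ℝ, 0 < C ∧ ∀ L : ℝ, 1 ≤ L → ∀ T : ℝ, 4 ≤ T →
    ∀ (W R : ℝ → ℝ) (E₁ IW IR D : ℝ),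
      (∀ t ∈ Icc T (2 * T), |W t + R t + (primeV L t).re + (offR L t).re| ≤ E₁) →
      ContinuousOn W (Icc T (2 * T)) → ContinuousOn R (Icc T (2 * T)) →
      |∫ t in T..(2 * T), W t| ≤ IW → ∫ t in T..(2 * T), |R t| ≤ IR →
      ∀ M₀ : ℝ, 0 ≤ M₀ →
        M₀ * (2 * π * (g0 0).re) + 1 ≤ D - 2 * E₁ - (C * L * Real.exp (L / 8) * Real.log (T + 2) + IW + IR) / T →
        ((∃ t₁ ∈ Icc T (2 * T), D ≤ W t₁ + R t₁) → ∃ u ∈ Icc (T / 2) (3 * T), M₀ ≤ zetaArgS u) ∧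
        ((∃ t₂ ∈ Icc T (2 * T), W t₂ + R t₂ ≤ -D) → ∃ u ∈ Icc (T / 2) (3 * T), zetaArgS u ≤ -M₀) := by
  obtain ⟨C₁, hC₁0, hC₁⟩ := exists_smoothS_increment_bound
  obtain ⟨C₂, hC₂0, hC₂⟩ := exists_abs_integral_smoothS_le
  obtain ⟨C₃, hC₃0, hC₃⟩ := exists_smoothS_sub_near_le
  refine ⟨2 * C₁ + C₂ + C₃, by positivity, ?_⟩
  intro L hL T hT W R E₁ IW IR D hWR hWc hRc hIW hIR M₀ hM₀ hD'
  have hL0 : 0 < L := by linarith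
  have hT0 : 0 < T := by linarith
  have h12 : T ≤ 2 * T := by linarith
  have hm₀ : 0 < 2 * π * (g0 0).re := by positivity [g0_zero_re_pos]
  -- notation
  set Φ : ℝ → ℝ := smoothS L with hΦ
  set V : ℝ → ℝ := fun t ↦ (primeV L t).re with hV
  set Rr : ℝ → ℝ := fun t ↦ (offR L t).re with hRr
  set CT : ℝ := Φ T + V T + Rr T with hCT
  set ε : ℝ := C₁ * L * Real.exp (L / 8) / T with hε
  have hε0 : 0 ≤ ε := by positivity
  -- (1) the convolution identity on `[T, 2T]`
  have hincr : ∀ t ∈ Icc T (2 * T), |Φ t - CT + V t + Rr t| ≤ ε := by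
    intro t ht
    have h := hC₁ L hL T t hT0.le ht.1
    have hbound : C₁ * L * Real.exp (L / 8) * (t - T) / (1 + T ^ 2) ≤ ε := by
      rw [hε, div_le_div_iff₀ (by positivity) hT0]
      have h1 : (t - T) * T ≤ 1 + T ^ 2 := by nlinarith [ht.2]
      calc C₁ * L * Real.exp (L / 8) * (t - T) * T = C₁ * L * Real.exp (L / 8) * ((t - T) * T) := by ring
        _ ≤ C₁ * L * Real.exp (L / 8) * (1 + T ^ 2) := mul_le_mul_of_nonneg_left h1 (by positivity)
    have e : Φ t - CT + V t + Rr t = (smoothS L t - smoothS L T) + ((primeV L t).re - (primeV L T).re) +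
        ((offR L t).re - (offR L T).re) := by rw [hCT]; ring
    rw [e]; exact h.trans hbound
  -- (2) the error `e = W + R + V + ℛ`
  have hVc : Continuous V := Complex.continuous_re.comp (continuous_primeV L)
  have hRrc : Continuous Rr := Complex.continuous_re.comp (continuous_offR hL)
  have hIcc : uIcc T (2 * T) = Icc T (2 * T) := uIcc_of_le h12
  have hWi : IntervalIntegrable W volume T (2 * T) := (hIcc ▸ hWc).intervalIntegrable
  have hRi : IntervalIntegrable R volume T (2 * T) := (hIcc ▸ hRc).intervalIntegrable
  have hVi : IntervalIntegrable V volume T (2 * T) := hVc.intervalIntegrable _ _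
  have hRri : IntervalIntegrable Rr volume T (2 * T) := hRrc.intervalIntegrable _ _
  have hΦi : IntervalIntegrable Φ volume T (2 * T) := intervalIntegrable_smoothS hL hT0.le
  have hIoc_sub : ∀ t ∈ Set.uIoc T (2 * T), t ∈ Icc T (2 * T) := fun t ht ↦ by
    rw [uIoc_of_le h12] at ht; exact ⟨ht.1.le, ht.2⟩
  -- (3) the constant of integration
  have hCT_le : |CT| ≤ (C₂ * L * Real.log (T + 2) + IW + IR) / T + E₁ + ε := by
    -- integrate (1)
    have hI1 : |∫ t in T..(2 * T), (Φ t - CT + V t + Rr t)| ≤ ε * T := by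
      have h := intervalIntegral.norm_integral_le_of_norm_le_const (a := T) (b := 2 * T) (C := ε)
        (f := fun t ↦ Φ t - CT + V t + Rr t) fun t ht ↦ by
          rw [Real.norm_eq_abs]; exact hincr t (hIoc_sub t ht)
      rw [Real.norm_eq_abs, show |2 * T - T| = T by rw [show 2 * T - T = T by ring, abs_of_pos hT0]] at h
      exact h
    have hsplit : ∫ t in T..(2 * T), (Φ t - CT + V t + Rr t) =
        (∫ t in T..(2 * T), Φ t) - CT * T + ∫ t in T..(2 * T), (V t + Rr t) := by
      rw [show (fun t ↦ Φ t - CT + V t + Rr t) = fun t ↦ (Φ t - CT) + (V t + Rr t) from funext fun t ↦ by ring,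
        intervalIntegral.integral_add ((hΦi.sub intervalIntegrable_const)) (hVi.add hRri),
        intervalIntegral.integral_sub hΦi intervalIntegrable_const, intervalIntegral.integral_const]
      simp only [smul_eq_mul]; ring
    -- `∫ (V + ℛ) = -∫ W - ∫ R + ∫ e`
    have hE1 : 0 ≤ E₁ := le_trans (abs_nonneg _) (hWR T ⟨le_rfl, h12⟩)
    have hI2 : |∫ t in T..(2 * T), (V t + Rr t)| ≤ IW + IR + E₁ * T := by
      have he : ∫ t in T..(2 * T), (V t + Rr t) =
          -(∫ t in T..(2 * T), W t) - (∫ t in T..(2 * T), R t) + ∫ t in T..(2 * T), (W t + R t + V t + Rr t) := by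
        rw [show (fun t ↦ W t + R t + V t + Rr t) = fun t ↦ (W t + R t) + (V t + Rr t) from funext fun t ↦ by ring,
          intervalIntegral.integral_add (hWi.add hRi) (hVi.add hRri), intervalIntegral.integral_add hWi hRi]; ring
      rw [he]
      have h3 : |∫ t in T..(2 * T), (W t + R t + V t + Rr t)| ≤ E₁ * T := by
        have h := intervalIntegral.norm_integral_le_of_norm_le_const (a := T) (b := 2 * T) (C := E₁)
          (f := fun t ↦ W t + R t + V t + Rr t) fun t ht ↦ by
            rw [Real.norm_eq_abs]; exact hWR t (hIoc_sub t ht)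
        rw [Real.norm_eq_abs, show |2 * T - T| = T by rw [show 2 * T - T = T by ring, abs_of_pos hT0]] at h
        exact h
      have h4 : |∫ t in T..(2 * T), R t| ≤ IR :=
        (intervalIntegral.abs_integral_le_integral_abs h12).trans hIR
      calc |-(∫ t in T..(2 * T), W t) - (∫ t in T..(2 * T), R t) + ∫ t in T..(2 * T), (W t + R t + V t + Rr t)|
          ≤ |-(∫ t in T..(2 * T), W t) - (∫ t in T..(2 * T), R t)| + |∫ t in T..(2 * T), (W t + R t + V t + Rr t)| :=
            abs_add_le _ _
        _ ≤ (|∫ t in T..(2 * T), W t| + |∫ t in T..(2 * T), R t|) + E₁ * T := by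
            gcongr
            calc |-(∫ t in T..(2 * T), W t) - (∫ t in T..(2 * T), R t)|
                ≤ |-(∫ t in T..(2 * T), W t)| + |∫ t in T..(2 * T), R t| := abs_sub _ _
              _ = _ := by rw [abs_neg]
        _ ≤ IW + IR + E₁ * T := by linarith
    have hI3 := hC₂ L hL T hT
    -- combine: `|CT| T ≤ |∫Φ| + |∫(V+ℛ)| + εT`
    have hkey : |CT * T| ≤ C₂ * L * Real.log (T + 2) + (IW + IR + E₁ * T) + ε * T := by
      have e : CT * T = (∫ t in T..(2 * T), Φ t) + (∫ t in T..(2 * T), (V t + Rr t)) -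
          ∫ t in T..(2 * T), (Φ t - CT + V t + Rr t) := by rw [hsplit]; ring
      rw [e]
      calc |(∫ t in T..(2 * T), Φ t) + (∫ t in T..(2 * T), (V t + Rr t)) - ∫ t in T..(2 * T), (Φ t - CT + V t + Rr t)|
          ≤ |(∫ t in T..(2 * T), Φ t) + (∫ t in T..(2 * T), (V t + Rr t))| + |∫ t in T..(2 * T), (Φ t - CT + V t + Rr t)| :=
            abs_sub _ _
        _ ≤ (|∫ t in T..(2 * T), Φ t| + |∫ t in T..(2 * T), (V t + Rr t)|) + ε * T := add_le_add (abs_add_le _ _) hI1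
        _ ≤ _ := by linarith
    rw [abs_mul, abs_of_pos hT0] at hkey
    rw [div_add' _ _ _ hT0.ne', div_add' _ _ _ hT0.ne', le_div_iff₀ hT0]
    linarith
  -- (4) near/far and the two conclusions
  have hD'' : ∀ t ∈ Icc T (2 * T), |CT| + E₁ + ε + C₃ / T ≤
      D - (M₀ * (2 * π * (g0 0).re) + 1) := by
    intro t _
    have hlog1 : 1 ≤ Real.log (T + 2) := by
      rw [Real.le_log_iff_exp_le (by linarith)]; linarith [Real.exp_one_lt_d9]
    have hexp1 : 1 ≤ Real.exp (L / 8) := Real.one_le_exp (by positivity)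
    have hbig : 2 * C₁ * L * Real.exp (L / 8) + C₂ * L * Real.log (T + 2) + C₃ ≤
        (2 * C₁ + C₂ + C₃) * L * Real.exp (L / 8) * Real.log (T + 2) := by
      have h1 : C₁ * L * Real.exp (L / 8) ≤ C₁ * L * Real.exp (L / 8) * Real.log (T + 2) :=
        le_mul_of_one_le_right (by positivity) hlog1
      have h2 : C₂ * L * Real.log (T + 2) ≤ C₂ * L * Real.exp (L / 8) * Real.log (T + 2) := by
        have := le_mul_of_one_le_right (by positivity : 0 ≤ C₂ * L * Real.log (T + 2)) hexp1; linarith [this]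
      have h3 : C₃ ≤ C₃ * L * Real.exp (L / 8) * Real.log (T + 2) := by
        have := le_mul_of_one_le_right hC₃0.le (show (1 : ℝ) ≤ L * Real.exp (L / 8) * Real.log (T + 2) from
          one_le_mul_of_one_le_of_one_le (one_le_mul_of_one_le_of_one_le hL hexp1) hlog1)
        linarith [this]
      linarith
    have hdiv : (2 * C₁ * L * Real.exp (L / 8) + C₂ * L * Real.log (T + 2) + C₃ + IW + IR) / T ≤
        ((2 * C₁ + C₂ + C₃) * L * Real.exp (L / 8) * Real.log (T + 2) + IW + IR) / T :=
      div_le_div_of_nonneg_right (by linarith) hT0.le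
    have e : |CT| + E₁ + ε + C₃ / T ≤ (C₂ * L * Real.log (T + 2) + IW + IR) / T + E₁ + ε + E₁ + ε + C₃ / T := by
      linarith [hCT_le]
    have e2 : (C₂ * L * Real.log (T + 2) + IW + IR) / T + E₁ + ε + E₁ + ε + C₃ / T =
        2 * E₁ + (2 * C₁ * L * Real.exp (L / 8) + C₂ * L * Real.log (T + 2) + C₃ + IW + IR) / T := by
      rw [hε]; field_simp; ring
    linarith
  have hnear := hC₃ L hL T (by linarith)
  constructor
  · rintro ⟨t₁, ht₁, hDt₁⟩
    by_contra hcon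
    push Not at hcon
    have hS : ∀ u ∈ Icc (T / 2) (3 * T), zetaArgS u ≤ M₀ := fun u hu ↦ (hcon u hu).le
    have h1 := near_integral_le hL hT0.le hM₀ hS ht₁
    have h2 := hnear t₁ ht₁
    have h3 := hincr t₁ ht₁
    have h4 := hWR t₁ ht₁
    have h5 := hD'' t₁ ht₁
    -- `Φ t₁ ≥ CT - V - ℛ - ε ≥ -|CT| + (W + R) - E₁ - ε`
    have hΦ1 : -|CT| + D - E₁ - ε ≤ Φ t₁ := by
      have := neg_abs_le CT
      rw [abs_le] at h3 h4
      linarith [h3.1, h4.2]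
    rw [abs_le] at h2
    linarith [h2.2]
  · rintro ⟨t₂, ht₂, hDt₂⟩
    by_contra hcon
    push Not at hcon
    have hS : ∀ u ∈ Icc (T / 2) (3 * T), -M₀ ≤ zetaArgS u := fun u hu ↦ (hcon u hu).le
    have h1 := neg_le_near_integral hL hT0.le hM₀ hS ht₂
    have h2 := hnear t₂ ht₂
    have h3 := hincr t₂ ht₂
    have h4 := hWR t₂ ht₂
    have h5 := hD'' t₂ ht₂
    have hΦ2 : Φ t₂ ≤ |CT| - D + E₁ + ε := by
      have := le_abs_self CT
      rw [abs_le] at h3 h4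
      linarith [h3.2, h4.1]
    rw [abs_le] at h2
    linarith [h2.1]

end FromWR

/-! ## F1: the prime side — `Re 𝒱_L = -2 F + (prime powers)` -/

section PrimeSide

/-- The coefficients `a_p = g_L(log p)/√p` of the prime polynomial. [folklore] -/
def aCoef (L : ℝ) (p : ℕ) : ℝ := (gDil L (Real.log p)).re / Real.sqrt p

/-- The primes `p ≤ e^{L/4}`. [folklore] -/
def primesP (L : ℝ) : Finset ℕ := (Finset.range (nCut L + 1)).filter Nat.Prime

/-- The prime polynomial in the form of `SelbergArgOmegaPrimeMoments`:
`F(t) = Im ∑_p a_p e^{-it log p} = -∑_p a_p sin(t log p)`. [folklore] -/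
def primeF (L t : ℝ) : ℝ :=
  (∑ p ∈ primesP L, (aCoef L p : ℂ) * cexp (↑(-1 * Real.log p * t) * I)).im

/-- The prime-power part of `Re 𝒱_L`. [folklore] -/
def primePowPart (L t : ℝ) : ℝ :=
  ∑ n ∈ (Finset.range (nCut L + 1)).filter (fun n ↦ ¬ n.Prime),
    (Λ n : ℝ) / Real.sqrt n * (gDil L (Real.log n)).re * (2 * Real.sin (t * Real.log n) / Real.log n)

/-- Membership in `primesP L`. [folklore] -/
theorem mem_primesP {L : ℝ} {p : ℕ} : p ∈ primesP L ↔ p ≤ nCut L ∧ p.Prime := by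
  simp [primesP]

/-- `(i/ℓ)(e^{-itℓ} - e^{itℓ}) = 2 sin(tℓ)/ℓ`. [folklore] -/
theorem I_div_mul_exp_sub_exp (t ℓ : ℝ) :
    (I / (ℓ : ℂ)) * (cexp ((((-(t * ℓ)) : ℝ) : ℂ) * I) - cexp (((t * ℓ : ℝ) : ℂ) * I)) =
      ((2 * Real.sin (t * ℓ) / ℓ : ℝ) : ℂ) := by
  have hdiff : cexp ((((-(t * ℓ)) : ℝ) : ℂ) * I) - cexp (((t * ℓ : ℝ) : ℂ) * I) =
      -(2 * Complex.sin ((t * ℓ : ℝ) : ℂ) * I) := by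
    rw [Complex.exp_mul_I, Complex.exp_mul_I]
    push_cast
    rw [Complex.cos_neg, Complex.sin_neg]
    ring
  rw [hdiff, show I / (ℓ : ℂ) * -(2 * Complex.sin ((t * ℓ : ℝ) : ℂ) * I) =
    -(I * I) * (2 * Complex.sin ((t * ℓ : ℝ) : ℂ)) / (ℓ : ℂ) by ring, I_mul_I]
  push_cast
  ring

/-- **`Re 𝒱_L` termwise**: `Re 𝒱_L(t) = ∑_{n ≤ e^{L/4}} (Λ(n)/√n) g_L(log n) · 2 sin(t log n)/log n`. [folklore] -/
theorem re_primeV (L t : ℝ) : (primeV L t).re =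
    ∑ n ∈ Finset.range (nCut L + 1),
      (Λ n : ℝ) / Real.sqrt n * (gDil L (Real.log n)).re * (2 * Real.sin (t * Real.log n) / Real.log n) := by
  rw [primeV, Complex.re_sum]
  refine Finset.sum_congr rfl fun n _ ↦ ?_
  rw [I_div_mul_exp_sub_exp, gDil_eq_re L (Real.log n)]
  have e : (((Λ n : ℝ)) : ℂ) / (Real.sqrt n : ℂ) * ((((gDil L (Real.log n)).re : ℝ) : ℂ) *
      ((2 * Real.sin (t * Real.log n) / Real.log n : ℝ) : ℂ)) =
      (((Λ n : ℝ) / Real.sqrt n * (gDil L (Real.log n)).re * (2 * Real.sin (t * Real.log n) / Real.log n) : ℝ) : ℂ) := by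
    push_cast; ring
  rw [e, Complex.ofReal_re]
  simp only [Complex.ofReal_re]

/-- `Im (a e^{ix}) = a sin x` for real `a, x`. [folklore] -/
theorem im_ofReal_mul_exp (a x : ℝ) : ((a : ℂ) * cexp ((x : ℂ) * I)).im = a * Real.sin x := by
  rw [Complex.exp_mul_I]
  simp [Complex.mul_im, Complex.add_im, Complex.add_re, Complex.cos_ofReal_im, Complex.sin_ofReal_im,
    Complex.sin_ofReal_re, Complex.mul_re]

/-- **`Re 𝒱_L = -2F + (prime powers)`.** [folklore] -/
theorem re_primeV_eq (L t : ℝ) : (primeV L t).re = -2 * primeF L t + primePowPart L t := by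
  classical
  rw [re_primeV, ← Finset.sum_filter_add_sum_filter_not _ Nat.Prime, primePowPart]
  congr 1
  rw [primeF, Complex.im_sum, Finset.mul_sum]
  refine Finset.sum_congr rfl fun p hp ↦ ?_
  have hp2 : p.Prime := (mem_primesP.1 hp).2
  have hlog : Real.log p ≠ 0 := (Real.log_pos (by exact_mod_cast hp2.one_lt)).ne'
  rw [show (↑(-1 * Real.log p * t) : ℂ) = ((-(t * Real.log p) : ℝ) : ℂ) by push_cast; ring, im_ofReal_mul_exp,
    ArithmeticFunction.vonMangoldt_apply_prime hp2, aCoef, Real.sin_neg]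
  field_simp

/-- **The prime powers are negligible**: `|∑_{n ≤ x, n ≠ p} …| ≤ 2(∫φ) · log₂ x · (1 + log x)` with
`x = ⌊e^{L/4}⌋`; in particular `O(L²)`. (For a prime power `n = p^j`, `j ≥ 2`: `1/√n ≤ 1/p`, and there
are at most `log₂ x` exponents `j`.) [folklore] -/
theorem abs_primePowPart_le {L : ℝ} (hL : 0 ≤ L) (t : ℝ) :
    |primePowPart L t| ≤ 2 * bumpMass * (Nat.log 2 (nCut L) + 1) * (1 + L / 4) := by
  classical
  set x : ℕ := nCut L with hx
  set K : ℕ := Nat.log 2 x with hK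
  set S := ((Finset.range (x + 1)).filter (fun n ↦ ¬ n.Prime)).filter IsPrimePow with hS
  -- termwise bound and reduction to `S`
  have hterm : ∀ n ∈ (Finset.range (x + 1)).filter (fun n ↦ ¬ n.Prime),
      |(Λ n : ℝ) / Real.sqrt n * (gDil L (Real.log n)).re * (2 * Real.sin (t * Real.log n) / Real.log n)| ≤
        if IsPrimePow n then 2 * bumpMass / Real.sqrt n else 0 := by
    intro n hn
    split_ifs with hpp
    · have hn1 : 1 < n := hpp.one_lt
      have hn0 : (0 : ℝ) < n := by exact_mod_cast (zero_lt_one.trans hn1)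
      have hlog : 0 < Real.log n := Real.log_pos (by exact_mod_cast hn1)
      have hΛ : 0 ≤ (Λ n : ℝ) := ArithmeticFunction.vonMangoldt_nonneg
      have hΛle : (Λ n : ℝ) ≤ Real.log n := ArithmeticFunction.vonMangoldt_le_log
      have hg : |(gDil L (Real.log n)).re| ≤ bumpMass := (Complex.abs_re_le_norm _).trans (norm_gDil_le _ _)
      have hsin : |Real.sin (t * Real.log n)| ≤ 1 := Real.abs_sin_le_one _
      have hsq : 0 < Real.sqrt n := Real.sqrt_pos.2 hn0
      rw [abs_mul, abs_mul, abs_div, abs_of_nonneg hΛ, abs_of_pos hsq, abs_div, abs_mul, abs_of_pos hlog,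
        abs_two]
      calc (Λ n : ℝ) / Real.sqrt n * |(gDil L (Real.log n)).re| * (2 * |Real.sin (t * Real.log n)| / Real.log n)
          ≤ Real.log n / Real.sqrt n * bumpMass * (2 * 1 / Real.log n) :=
            mul_le_mul (mul_le_mul (div_le_div_of_nonneg_right hΛle hsq.le) hg (abs_nonneg _)
              (div_nonneg hlog.le hsq.le)) (by gcongr) (div_nonneg (by positivity) hlog.le)
              (mul_nonneg (div_nonneg hlog.le hsq.le) bumpMass_pos.le)
        _ = 2 * bumpMass / Real.sqrt n := by field_simp
    · rw [ArithmeticFunction.vonMangoldt_eq_zero_iff.2 hpp]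
      simp
  have h1 : |primePowPart L t| ≤ ∑ n ∈ S, 2 * bumpMass / Real.sqrt n := by
    rw [primePowPart]
    refine (Finset.abs_sum_le_sum_abs _ _).trans ((Finset.sum_le_sum hterm).trans (le_of_eq ?_))
    rw [hS]
    exact (Finset.sum_filter _ _).symm
  -- `S` is covered by `(p, j) ↦ p^j`, `p ∈ primesP`, `2 ≤ j ≤ K`
  have hcover : S ⊆ ((primesP L) ×ˢ Finset.Icc 2 K).image (fun q : ℕ × ℕ ↦ q.1 ^ q.2) := by
    intro n hn
    rw [hS, Finset.mem_filter, Finset.mem_filter, Finset.mem_range] at hn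
    obtain ⟨⟨hnx, hnp⟩, hpp⟩ := hn
    obtain ⟨q, j, hq, hj, rfl⟩ := (isPrimePow_nat_iff _).1 hpp
    rw [Finset.mem_image]
    refine ⟨(q, j), ?_, rfl⟩
    rw [Finset.mem_product, mem_primesP, Finset.mem_Icc]
    have hj2 : 2 ≤ j := by
      by_contra h
      have : j = 1 := by omega
      subst this
      exact hnp (by simpa using hq)
    have hnx' : q ^ j ≤ x := Nat.lt_succ_iff.1 hnx
    have hqx : q ≤ x := le_trans (Nat.le_self_pow (by omega) q) hnx'
    refine ⟨⟨hqx, hq⟩, hj2, ?_⟩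
    rw [hK]
    refine Nat.le_log_of_pow_le one_lt_two ?_
    exact le_trans (Nat.pow_le_pow_left hq.two_le j) hnx'
  have h2 : ∑ n ∈ S, 2 * bumpMass / Real.sqrt n ≤
      ∑ q ∈ (primesP L) ×ˢ Finset.Icc 2 K, 2 * bumpMass / Real.sqrt ((q.1 ^ q.2 : ℕ) : ℝ) := by
    refine (Finset.sum_le_sum_of_subset_of_nonneg hcover fun n _ _ ↦ by positivity [bumpMass_pos]).trans ?_
    exact Finset.sum_image_le_of_nonneg fun n _ ↦ by positivity [bumpMass_pos]
  -- each term `≤ 2 bumpMass / p`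
  have h3 : ∑ q ∈ (primesP L) ×ˢ Finset.Icc 2 K, 2 * bumpMass / Real.sqrt ((q.1 ^ q.2 : ℕ) : ℝ) ≤
      ∑ q ∈ (primesP L) ×ˢ Finset.Icc 2 K, 2 * bumpMass / (q.1 : ℝ) := by
    refine Finset.sum_le_sum fun q hq ↦ ?_
    rw [Finset.mem_product, mem_primesP, Finset.mem_Icc] at hq
    have hp := hq.1.2
    have hp0 : (0 : ℝ) < q.1 := by exact_mod_cast hp.pos
    refine div_le_div_of_nonneg_left (by positivity [bumpMass_pos]) hp0 ?_
    calc (q.1 : ℝ) = Real.sqrt ((q.1 : ℝ) ^ 2) := (Real.sqrt_sq hp0.le).symm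
      _ ≤ Real.sqrt ((q.1 ^ q.2 : ℕ) : ℝ) := Real.sqrt_le_sqrt (by exact_mod_cast Nat.pow_le_pow_right hp.pos hq.2.1)
  have h4 : ∑ q ∈ (primesP L) ×ˢ Finset.Icc 2 K, 2 * bumpMass / (q.1 : ℝ) ≤
      2 * bumpMass * (K + 1) * ∑ p ∈ primesP L, (p : ℝ)⁻¹ := by
    rw [Finset.sum_product]
    simp only [Finset.sum_const, Nat.card_Icc, nsmul_eq_mul]
    rw [Finset.mul_sum]
    refine Finset.sum_le_sum fun p hp ↦ ?_
    have hp0 : (0 : ℝ) < p := by exact_mod_cast (mem_primesP.1 hp).2.pos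
    have hK1 : ((K + 1 - 2 : ℕ) : ℝ) ≤ K + 1 := by
      have : K + 1 - 2 ≤ K + 1 := Nat.sub_le _ _
      exact_mod_cast this
    calc ((K + 1 - 2 : ℕ) : ℝ) * (2 * bumpMass / (p : ℝ)) ≤ ((K : ℝ) + 1) * (2 * bumpMass / (p : ℝ)) :=
          mul_le_mul_of_nonneg_right hK1 (by positivity [bumpMass_pos])
      _ = _ := by ring
  -- `∑_{p ≤ x} 1/p ≤ 1 + log x ≤ 1 + L/4`
  have h5 : ∑ p ∈ primesP L, (p : ℝ)⁻¹ ≤ 1 + L / 4 := by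
    have hsub : primesP L ⊆ Finset.Icc 1 x := by
      intro p hp
      rw [mem_primesP] at hp
      rw [Finset.mem_Icc]; exact ⟨hp.2.pos, hp.1⟩
    have hharm := harmonic_le_one_add_log x
    rw [harmonic_eq_sum_Icc] at hharm
    push_cast at hharm
    have hlogx : Real.log x ≤ L / 4 := by
      rcases Nat.eq_zero_or_pos x with h0 | hpos
      · rw [h0]; simp; positivity
      · have hxle : (x : ℝ) ≤ Real.exp (L / 4) := by rw [hx]; exact Nat.floor_le (Real.exp_pos _).le
        calc Real.log x ≤ Real.log (Real.exp (L / 4)) := Real.log_le_log (by exact_mod_cast hpos) hxle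
          _ = L / 4 := Real.log_exp _
    calc ∑ p ∈ primesP L, (p : ℝ)⁻¹ ≤ ∑ i ∈ Finset.Icc 1 x, (i : ℝ)⁻¹ :=
          Finset.sum_le_sum_of_subset_of_nonneg hsub fun i _ _ ↦ by positivity
      _ ≤ 1 + Real.log x := hharm
      _ ≤ 1 + L / 4 := by linarith
  calc |primePowPart L t| ≤ 2 * bumpMass * (K + 1) * ∑ p ∈ primesP L, (p : ℝ)⁻¹ := h1.trans (h2.trans (h3.trans h4))
    _ ≤ 2 * bumpMass * (K + 1) * (1 + L / 4) :=
        mul_le_mul_of_nonneg_left h5 (by positivity [bumpMass_pos])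
    _ = _ := by rw [hK]

end PrimeSide

/-! ## F3b: the moments feed Lemma 4 -/

section Moments

/-- `a_p ≥ 0`. [folklore] -/
theorem aCoef_nonneg (L : ℝ) (p : ℕ) : 0 ≤ aCoef L p :=
  div_nonneg (gDil_re_nonneg _ _) (Real.sqrt_nonneg _)

/-- `F` is continuous. [folklore] -/
theorem continuous_primeF (L : ℝ) : Continuous (primeF L) :=
  Tsang1986.continuous_im_primePoly (aCoef L) (primesP L)

set_option maxHeartbeats 400000 in
/-- **The parametric core of the assembly.** Under the zero-density hypothesis, with the constants
`K, T₀` of `offR_moment_le_of_density` and `C` of `exists_zetaArgS_large_of_WR`: for `T ≥ T₀`, `L`, `k`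
in the admissible ranges, a sub-range `P'` of the primes `≤ e^{L/4}` with `a_p² ≤ μ` on `P'` and
`(k-1)μ ≤ S'/2` (`S' = ∑_{P'} a_p²`), a number `m > 0` with `m^{2k} ≤ Y := C(2k,k) 4^{-k} k! (S'/2)^k/2`,
the two error conditions of the prime moments and `M₂ ≤ m` for
`M₂ := 2 max(X, 1) (K log^B T + 1)^{1/(2k+1)}`, `X := K L²(2k+1)²/log T`, every `M₀ ≥ 0` with
`2π g₀(0) M₀ + 1 ≤ (m - M₂) - 2E₁ - (C L e^{L/8} log(T+2) + 8 e^{L/4} 𝔄 + T M₂)/T`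
(`E₁` the prime-power bound, `𝔄 = ∑_p |a_p|`) is exceeded by `S` and by `-S` on `[T/2, 3T]`.
[cite: Tsang1986, §3 pp. 382–384] -/
theorem exists_zetaArgS_large_of_params {A B Cd : ℝ} (hA : 0 < A) (hB : 0 ≤ B) (hCd : 0 ≤ Cd)
    (hDen : ∀ σ H : ℝ, 1 / 2 ≤ σ → σ ≤ 1 → 2 ≤ H →
      (zetaZeroCountRe σ H : ℝ) ≤ Cd * H ^ (1 - A * (σ - 1 / 2)) * Real.log H ^ B) :
    ∃ K : ℝ, 0 < K ∧ ∃ C : ℝ, 0 < C ∧ ∃ T₀ : ℝ, 4 ≤ T₀ ∧ ∀ T : ℝ, T₀ ≤ T → ∀ L : ℝ, 1 ≤ L → L ≤ Real.log T →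
      Real.exp (L / 8) ≤ T ^ (1 / 4 : ℝ) → ∀ k : ℕ, 2 ≤ k → ((2 * k + 1 : ℕ) : ℝ) * L ≤ A * Real.log T →
      ∀ (P' : Finset ℕ) (μ m M₀ : ℝ), P' ⊆ primesP L → 0 ≤ μ → (∀ p ∈ P', aCoef L p ^ 2 ≤ μ) →
      ((k : ℝ) - 1) * μ ≤ (∑ p ∈ P', aCoef L p ^ 2) / 2 → 0 < m →
      m ^ (2 * k) ≤ ((2 * k).choose k : ℝ) / 4 ^ k * (k.factorial : ℝ) * ((∑ p ∈ P', aCoef L p ^ 2) / 2) ^ k / 2 →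
      -- the two error conditions of the prime moments
      2 * Real.exp (L / 4) ^ (2 * k) * (∑ p ∈ primesP L, |aCoef L p|) ^ (2 * k) ≤
        T * (((2 * k).choose k : ℝ) / 4 ^ k * (k.factorial : ℝ) * ((∑ p ∈ P', aCoef L p ^ 2) / 2) ^ k / 2) →
      4 * Real.exp (L / 4) ^ (2 * k + 1) * (∑ p ∈ primesP L, |aCoef L p|) ^ (2 * k + 1) ≤
        T * (((2 * k).choose k : ℝ) / 4 ^ k * (k.factorial : ℝ) * ((∑ p ∈ P', aCoef L p ^ 2) / 2) ^ k / 2) * m →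
      -- the off-line term is dominated
      2 * max (K * L ^ 2 * ((2 * k + 1 : ℕ) : ℝ) ^ 2 / Real.log T) 1 *
        (K * Real.log T ^ B + 1) ^ (((2 * k + 1 : ℕ) : ℝ)⁻¹) ≤ m →
      0 ≤ M₀ →
      M₀ * (2 * π * (g0 0).re) + 1 ≤ (m - 2 * max (K * L ^ 2 * ((2 * k + 1 : ℕ) : ℝ) ^ 2 / Real.log T) 1 *
          (K * Real.log T ^ B + 1) ^ (((2 * k + 1 : ℕ) : ℝ)⁻¹)) -
        2 * (2 * bumpMass * (Nat.log 2 (nCut L) + 1) * (1 + L / 4)) -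
        (C * L * Real.exp (L / 8) * Real.log (T + 2) + 8 * Real.exp (L / 4) * (∑ p ∈ primesP L, |aCoef L p|) +
          T * (2 * max (K * L ^ 2 * ((2 * k + 1 : ℕ) : ℝ) ^ 2 / Real.log T) 1 *
            (K * Real.log T ^ B + 1) ^ (((2 * k + 1 : ℕ) : ℝ)⁻¹))) / T →
      (∃ u ∈ Icc (T / 2) (3 * T), M₀ ≤ zetaArgS u) ∧ (∃ u ∈ Icc (T / 2) (3 * T), zetaArgS u ≤ -M₀) := by
  obtain ⟨K, hK0, T₀, hT₀1, hmom⟩ := offR_moment_le_of_density hA hB hCd hDen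
  obtain ⟨C, hC0, hWR⟩ := exists_zetaArgS_large_of_WR
  refine ⟨K, hK0, C, hC0, max T₀ 4, le_max_right _ _, ?_⟩
  intro T hT L hL hLlog hexpL k hk hkL P' μ m M₀ hP' hμ haμ hkμ hm hmY hE1 hE2 hM₂m hM₀ hmain
  have hT4 : 4 ≤ T := (le_max_right _ _).trans hT
  have hTT₀ : T₀ ≤ T := (le_max_left _ _).trans hT
  have hT0 : 0 < T := by linarith
  have h12 : T ≤ 2 * T := by linarith
  have hL0 : 0 < L := by linarith
  have hlogT : 0 < Real.log T := Real.log_pos (by linarith)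
  -- notation
  set ν : ℕ := 2 * k + 1 with hν
  set S' : ℝ := ∑ p ∈ P', aCoef L p ^ 2 with hS'
  set Abs : ℝ := ∑ p ∈ primesP L, |aCoef L p| with hAbs
  set xr : ℝ := Real.exp (L / 4) with hxr
  set Y : ℝ := ((2 * k).choose k : ℝ) / 4 ^ k * (k.factorial : ℝ) * (S' / 2) ^ k / 2 with hY
  set X : ℝ := K * L ^ 2 * (ν : ℝ) ^ 2 / Real.log T with hX
  set M₂ : ℝ := 2 * max X 1 * (K * Real.log T ^ B + 1) ^ ((ν : ℝ)⁻¹) with hM₂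
  set M₁ : ℝ := 2 * Y ^ (((2 * k : ℕ) : ℝ)⁻¹) with hM₁
  set W : ℝ → ℝ := fun t ↦ 2 * primeF L t with hW
  set R : ℝ → ℝ := fun t ↦ -(offR L t).re with hR
  have hk1 : 1 ≤ k := by omega
  have hν5 : 5 ≤ ν := by omega
  have hS'0 : 0 ≤ S' := Finset.sum_nonneg fun p _ ↦ sq_nonneg _
  have hY0 : 0 ≤ Y := by positivity
  have hmY' : m ≤ Y ^ (((2 * k : ℕ) : ℝ)⁻¹) := by
    have h := Real.rpow_le_rpow (pow_nonneg hm.le _) hmY (inv_nonneg.2 (Nat.cast_nonneg (2 * k)))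
    rwa [Real.pow_rpow_inv_natCast hm.le (by omega)] at h
  have hM₁m : 2 * m ≤ M₁ := by rw [hM₁]; linarith
  have hM₁0 : 0 < M₁ := by linarith
  have hM₁pow : M₁ ^ (2 * k) = 2 ^ (2 * k) * Y := by
    rw [hM₁, mul_pow, Real.rpow_inv_natCast_pow hY0 (by omega)]
  have hlogB1 : 0 < K * Real.log T ^ B + 1 := by positivity
  have hQ1 : 1 ≤ (K * Real.log T ^ B + 1) ^ ((ν : ℝ)⁻¹) :=
    Real.one_le_rpow (by linarith [show 0 ≤ K * Real.log T ^ B by positivity]) (by positivity)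
  have hmax1 : 1 ≤ max X 1 := le_max_right _ _
  have hM₂0 : 0 < M₂ := by positivity
  have hM₂pow : M₂ ^ ν = 2 ^ ν * (max X 1) ^ ν * (K * Real.log T ^ B + 1) := by
    rw [hM₂, mul_pow, mul_pow, Real.rpow_inv_natCast_pow hlogB1.le (by omega)]
  -- step 4 inputs
  have hPr : ∀ p ∈ primesP L, p.Prime := fun p hp ↦ (mem_primesP.1 hp).2
  have hPx : ∀ p ∈ primesP L, (p : ℝ) ≤ xr := fun p hp ↦ by
    have h := (mem_primesP.1 hp).1
    calc (p : ℝ) ≤ nCut L := by exact_mod_cast h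
      _ ≤ xr := Nat.floor_le (Real.exp_pos _).le
  have hxr1 : 1 ≤ xr := Real.one_le_exp (by positivity)
  -- continuity
  have hWc : ContinuousOn W (Icc T (2 * T)) := (continuous_const.mul (continuous_primeF L)).continuousOn
  have hRc : ContinuousOn R (Icc T (2 * T)) := (Complex.continuous_re.comp (continuous_offR hL)).neg.continuousOn
  -- (h1) even moment
  have h1 : T * M₁ ^ (2 * k) ≤ ∫ t in T..(2 * T), W t ^ (2 * k) := by
    have hev := Tsang1986.integral_im_pow_even_ge_of_subset hPr hPx hxr1 (fun p _ ↦ aCoef_nonneg L p) hP' hμ haμ k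
      (by linarith) h12
    have hmain_ge : T * (2 * Y) ≤ ((2 * k).choose k : ℝ) / 4 ^ k * ((2 * T - T) * ((k.factorial : ℝ) *
        (S' - ((k : ℝ) - 1) * μ) ^ k)) := by
      have hge : S' / 2 ≤ S' - ((k : ℝ) - 1) * μ := by linarith
      have hpow : (S' / 2) ^ k ≤ (S' - ((k : ℝ) - 1) * μ) ^ k := pow_le_pow_left₀ (by positivity) hge k
      rw [show 2 * T - T = T by ring, hY]
      have : ((2 * k).choose k : ℝ) / 4 ^ k * (T * ((k.factorial : ℝ) * (S' / 2) ^ k)) ≤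
          ((2 * k).choose k : ℝ) / 4 ^ k * (T * ((k.factorial : ℝ) * (S' - ((k : ℝ) - 1) * μ) ^ k)) := by
        gcongr
      refine le_trans (le_of_eq ?_) this
      ring
    have hint_eq : ∫ t in T..(2 * T), W t ^ (2 * k) = 2 ^ (2 * k) * ∫ t in T..(2 * T), primeF L t ^ (2 * k) := by
      rw [← intervalIntegral.integral_const_mul]
      exact intervalIntegral.integral_congr fun t _ ↦ by simp only [hW, mul_pow]
    rw [hint_eq, hM₁pow]
    have hF : T * Y ≤ ∫ t in T..(2 * T), primeF L t ^ (2 * k) := by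
      have := hev; unfold primeF; linarith
    calc T * (2 ^ (2 * k) * Y) = 2 ^ (2 * k) * (T * Y) := by ring
      _ ≤ _ := mul_le_mul_of_nonneg_left hF (by positivity)
  -- (h2) odd moment
  have h2 : |∫ t in T..(2 * T), W t ^ (2 * k + 1)| ≤ T * M₁ ^ (2 * k + 1) / 2 := by
    have hodd := Tsang1986.abs_integral_im_pow_odd_le hPr hPx hxr1 (aCoef L) k T (2 * T)
    have hint_eq : ∫ t in T..(2 * T), W t ^ (2 * k + 1) = 2 ^ (2 * k + 1) * ∫ t in T..(2 * T), primeF L t ^ (2 * k + 1) := by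
      rw [← intervalIntegral.integral_const_mul]
      exact intervalIntegral.integral_congr fun t _ ↦ by simp only [hW, mul_pow]
    rw [hint_eq, abs_mul, abs_of_pos (by positivity : (0 : ℝ) < 2 ^ (2 * k + 1)),
      show M₁ ^ (2 * k + 1) = M₁ ^ (2 * k) * M₁ from pow_succ M₁ (2 * k), hM₁pow]
    have hodd' : |∫ t in T..(2 * T), primeF L t ^ (2 * k + 1)| ≤ 2 * xr ^ (2 * k + 1) * Abs ^ (2 * k + 1) := by
      rw [hAbs]; exact hodd
    calc 2 ^ (2 * k + 1) * |∫ t in T..(2 * T), primeF L t ^ (2 * k + 1)|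
        ≤ 2 ^ (2 * k + 1) * (2 * xr ^ (2 * k + 1) * Abs ^ (2 * k + 1)) := mul_le_mul_of_nonneg_left hodd' (by positivity)
      _ = 2 ^ (2 * k) * (4 * xr ^ (2 * k + 1) * Abs ^ (2 * k + 1)) := by ring
      _ ≤ 2 ^ (2 * k) * (T * Y * m) := mul_le_mul_of_nonneg_left hE2 (by positivity)
      _ ≤ 2 ^ (2 * k) * (T * Y * (M₁ / 2)) := by gcongr; linarith
      _ = T * (2 ^ (2 * k) * Y * M₁) / 2 := by ring
  -- (h3) the off-line moment
  have h3 : ∫ t in T..(2 * T), |R t| ^ (2 * k + 1) ≤ T * M₂ ^ (2 * k + 1) := by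
    have h := hmom T hTT₀ L hL hLlog hexpL ν hν5 hkL
    have hint_eq : ∫ t in T..(2 * T), |R t| ^ (2 * k + 1) = ∫ t in T..(2 * T), |(offR L t).re| ^ ν :=
      intervalIntegral.integral_congr fun t _ ↦ by simp only [hR, abs_neg, hν]
    rw [hint_eq]
    refine h.trans ?_
    rw [show 2 * k + 1 = ν from rfl, hM₂pow]
    have hT1 : 1 ≤ T := by linarith
    have hXν : X ^ ν ≤ (max X 1) ^ ν := by
      rcases le_or_gt 0 X with hX0 | hX0
      · exact pow_le_pow_left₀ hX0 (le_max_left _ _) ν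
      · have hodd : Odd ν := ⟨k, by omega⟩
        exact le_trans (hodd.pow_neg hX0).le (pow_nonneg (le_trans zero_le_one hmax1) _)
    have hmaxν : 1 ≤ (max X 1) ^ ν := one_le_pow₀ hmax1
    have hlogB0 : 0 ≤ K * Real.log T ^ B := by positivity
    calc (2 : ℝ) ^ ν * (K * Real.log T ^ B * T * X ^ ν + 1)
        ≤ 2 ^ ν * (K * Real.log T ^ B * T * (max X 1) ^ ν + T * (max X 1) ^ ν) := by
          have h1T : (1 : ℝ) ≤ T * (max X 1) ^ ν := le_trans hmaxν (le_mul_of_one_le_left (by positivity) hT1)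
          gcongr
      _ = T * (2 ^ ν * (max X 1) ^ ν * (K * Real.log T ^ B + 1)) := by ring
  -- (h4)
  have h4 : 2 * M₂ ≤ M₁ := by linarith
  -- Lemma 4
  obtain ⟨⟨t₁, ht₁, hD₁⟩, ⟨t₂, ht₂, hD₂⟩⟩ := Tsang1986_lemma4 hk1 hT0 hM₁0 hWc hRc h1 h2 h3 h4
  -- the inputs of `exists_zetaArgS_large_of_WR`
  have hE : ∀ t ∈ Icc T (2 * T), |W t + R t + (primeV L t).re + (offR L t).re| ≤
      2 * bumpMass * (Nat.log 2 (nCut L) + 1) * (1 + L / 4) := by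
    intro t _
    rw [re_primeV_eq, show W t + R t + (-2 * primeF L t + primePowPart L t) + (offR L t).re = primePowPart L t by
      simp only [hW, hR]; ring]
    exact abs_primePowPart_le hL0.le t
  have hIW : |∫ t in T..(2 * T), W t| ≤ 8 * xr * Abs := by
    have hodd := Tsang1986.abs_integral_im_pow_odd_le hPr hPx hxr1 (aCoef L) 0 T (2 * T)
    simp only [Nat.mul_zero, zero_add, pow_one] at hodd
    have hodd' : |∫ t in T..(2 * T), primeF L t| ≤ 2 * xr * Abs := by rw [hAbs]; exact hodd
    have hint_eq : ∫ t in T..(2 * T), W t = 2 * ∫ t in T..(2 * T), primeF L t := by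
      rw [← intervalIntegral.integral_const_mul]
    rw [hint_eq, abs_mul, abs_two]
    have hxr0 : 0 ≤ xr := (Real.exp_pos _).le
    have hAbs0 : 0 ≤ Abs := Finset.sum_nonneg fun p _ ↦ abs_nonneg _
    have hxa : 0 ≤ xr * Abs := mul_nonneg hxr0 hAbs0
    linarith
  have hIR : ∫ t in T..(2 * T), |R t| ≤ T * M₂ := by
    -- Jensen: `(T⁻¹ ∫ |R|)^ν ≤ T⁻¹ ∫ |R|^ν ≤ M₂^ν`
    have hTlt : T < 2 * T := by linarith
    have hJ := Tsang1986.rpow_average_pow_le hTlt (f := fun t ↦ |R t|) (hRc.abs) (fun t _ ↦ abs_nonneg _)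
      one_pos (show 1 ≤ ν by omega)
    simp only [pow_one, Nat.cast_one, div_one] at hJ
    rw [show 2 * T - T = T by ring] at hJ
    have hIcc : ∀ f : ℝ → ℝ, ∫ t in Icc T (2 * T), f t = ∫ t in T..(2 * T), f t := fun f ↦ by
      rw [intervalIntegral.integral_of_le h12, integral_Icc_eq_integral_Ioc]
    rw [hIcc, hIcc, Real.rpow_natCast] at hJ
    have hb : T⁻¹ * ∫ t in T..(2 * T), |R t| ^ ν ≤ M₂ ^ ν := by
      rw [inv_mul_le_iff₀ hT0]; exact h3
    have hy0 : 0 ≤ T⁻¹ * ∫ t in T..(2 * T), |R t| :=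
      mul_nonneg (inv_nonneg.2 hT0.le) (intervalIntegral.integral_nonneg h12 fun t _ ↦ abs_nonneg _)
    have hle : T⁻¹ * ∫ t in T..(2 * T), |R t| ≤ M₂ :=
      le_of_pow_le_pow_left₀ (by omega : ν ≠ 0) hM₂0.le (hJ.trans hb)
    rwa [inv_mul_le_iff₀ hT0] at hle
  have hres := hWR L hL T hT4 W R _ _ _ (m - M₂) hE hWc hRc hIW hIR M₀ hM₀ hmain
  refine ⟨hres.1 ⟨t₁, ht₁, ?_⟩, hres.2 ⟨t₂, ht₂, ?_⟩⟩
  · linarith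
  · linarith

end Moments

/-! ## F2: toolbox for the parameter choice -/

section Toolbox

/-- **`g₀ ≥ 1/16` near the origin**: for `|v| ≤ 1/16`, `Re g₀(v) = ∫ φ(u)φ(v-u) du ≥ 1/16`, since
`φ = 1` on `[-1/16, 1/16]` and the two plateaux overlap on an interval of length `1/8 - |v| ≥ 1/16`.
[folklore] -/
theorem g0_re_ge {v : ℝ} (hv : |v| ≤ 1 / 16) : 1 / 16 ≤ (g0 v).re := by
  -- reduce to `0 ≤ v`
  wlog hv0 : 0 ≤ v generalizing v
  · have h := this (v := -v) (by rwa [abs_neg]) (by linarith [le_of_not_ge hv0])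
    rwa [g0_neg] at h
  rw [abs_of_nonneg hv0] at hv
  rw [g0_re]
  set f : ℝ → ℝ := fun u ↦ bumpR u * bumpR (v - u) with hf
  have hcont : Continuous f := bumpR.continuous.mul (bumpR.continuous.comp (continuous_const.sub continuous_id))
  have hsupp : HasCompactSupport f := bumpR.hasCompactSupport.mul_right
  have hint : Integrable f := hcont.integrable_of_hasCompactSupport hsupp
  have hf0 : ∀ u, 0 ≤ f u := fun u ↦ mul_nonneg (bumpR_nonneg u) (bumpR_nonneg _)
  set A : Set ℝ := Icc (v - 1 / 16) (1 / 16) with hA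
  have hone : ∀ u ∈ A, f u = 1 := by
    intro u hu
    have h1 : bumpR u = 1 := bumpR.one_of_mem_closedBall (by
      rw [Metric.mem_closedBall, dist_zero_right, Real.norm_eq_abs, abs_le]
      show -(1 / 16 : ℝ) ≤ u ∧ u ≤ 1 / 16
      exact ⟨by linarith [hu.1], hu.2⟩)
    have h2 : bumpR (v - u) = 1 := bumpR.one_of_mem_closedBall (by
      rw [Metric.mem_closedBall, dist_zero_right, Real.norm_eq_abs, abs_le]
      show -(1 / 16 : ℝ) ≤ v - u ∧ v - u ≤ 1 / 16
      exact ⟨by linarith [hu.2], by linarith [hu.1]⟩)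
    simp [hf, h1, h2]
  have hvol : (volume A).toReal = 1 / 8 - v := by
    rw [hA, Real.volume_Icc, ENNReal.toReal_ofReal (by linarith)]; ring
  calc (1 / 16 : ℝ) ≤ 1 / 8 - v := by linarith
    _ = ∫ u in A, (1 : ℝ) := by rw [setIntegral_const, smul_eq_mul, mul_one, Measure.real, hvol]
    _ = ∫ u in A, f u := (setIntegral_congr_fun measurableSet_Icc hone).symm
    _ ≤ ∫ u, f u := setIntegral_le_integral hint (Eventually.of_forall hf0)

/-- `a_p² ≤ (∫φ)²/p`. [folklore] -/
theorem aCoef_sq_le (L : ℝ) {p : ℕ} (hp : 0 < p) : aCoef L p ^ 2 ≤ bumpMass ^ 2 / p := by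
  have hp0 : (0 : ℝ) < p := by exact_mod_cast hp
  rw [aCoef, div_pow, Real.sq_sqrt hp0.le]
  exact div_le_div_of_nonneg_right (pow_le_pow_left₀ (gDil_re_nonneg _ _)
    ((Complex.re_le_norm _).trans (norm_gDil_le _ _)) 2) hp0.le

/-- `|a_p| ≤ ∫φ` (`p ≥ 1`). [folklore] -/
theorem abs_aCoef_le (L : ℝ) {p : ℕ} (hp : 0 < p) : |aCoef L p| ≤ bumpMass := by
  rw [abs_of_nonneg (aCoef_nonneg L p), aCoef]
  have hp1 : (1 : ℝ) ≤ p := by exact_mod_cast hp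
  have hsq : 1 ≤ Real.sqrt p := by rw [Real.le_sqrt' one_pos]; simpa using hp1
  calc (gDil L (Real.log p)).re / Real.sqrt p ≤ (gDil L (Real.log p)).re / 1 :=
        div_le_div_of_nonneg_left (gDil_re_nonneg _ _) one_pos hsq
    _ ≤ bumpMass := by rw [div_one]; exact (Complex.re_le_norm _).trans (norm_gDil_le _ _)

/-- **The loud primes**: for `p ≤ e^{L/16}` (`L > 0`), `g_L(log p) ≥ 1/16`, so `a_p² ≥ 1/(256 p)`. [folklore] -/
theorem aCoef_sq_ge {L : ℝ} (hL : 0 < L) {p : ℕ} (hp : 0 < p) (hpL : Real.log p ≤ L / 16) :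
    1 / (256 * p) ≤ aCoef L p ^ 2 := by
  have hp0 : (0 : ℝ) < p := by exact_mod_cast hp
  have hlog0 : 0 ≤ Real.log p := Real.log_natCast_nonneg p
  have hg : 1 / 16 ≤ (gDil L (Real.log p)).re := by
    rw [gDil]
    refine g0_re_ge ?_
    rw [abs_div, abs_of_pos hL, abs_of_nonneg hlog0, div_le_div_iff₀ hL (by norm_num)]
    linarith
  rw [aCoef, div_pow, Real.sq_sqrt hp0.le, div_le_div_iff₀ (by positivity) hp0]
  nlinarith [pow_le_pow_left₀ (by norm_num : (0 : ℝ) ≤ 1 / 16) hg 2]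

/-- `∑_{p ≤ e^{L/4}} |a_p| ≤ (∫φ)(e^{L/4} + 1)`. [folklore] -/
theorem sum_abs_aCoef_le (L : ℝ) :
    ∑ p ∈ primesP L, |aCoef L p| ≤ bumpMass * (Real.exp (L / 4) + 1) := by
  calc ∑ p ∈ primesP L, |aCoef L p| ≤ ∑ p ∈ primesP L, bumpMass :=
        Finset.sum_le_sum fun p hp ↦ abs_aCoef_le L (mem_primesP.1 hp).2.pos
    _ = bumpMass * (primesP L).card := by rw [Finset.sum_const, nsmul_eq_mul, mul_comm]
    _ ≤ bumpMass * (Real.exp (L / 4) + 1) := by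
        refine mul_le_mul_of_nonneg_left ?_ bumpMass_pos.le
        have h1 : ((primesP L).card : ℝ) ≤ nCut L + 1 := by
          have := Finset.card_filter_le (Finset.range (nCut L + 1)) Nat.Prime
          rw [Finset.card_range] at this
          exact_mod_cast this
        have h2 : (nCut L : ℝ) ≤ Real.exp (L / 4) := Nat.floor_le (Real.exp_pos _).le
        linarith

/-- **Mertens on the window `(y^{3/4}, y]`**: for large `y`, `∑_{y^{3/4} < p ≤ y} 1/p ≥ (log (4/3))/2`.
[cite: HardyWright2008, Thm 427] -/
theorem exists_primeRecipSum_window_ge : ∃ y₀ : ℝ, 1 ≤ y₀ ∧ ∀ y : ℝ, y₀ ≤ y →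
    Real.log (4 / 3) / 2 ≤ Mertens.primeRecipSum y - Mertens.primeRecipSum (y ^ (3 / 4 : ℝ)) := by
  have h := Mertens.tendsto_primeRecipSum_sub_loglog
  have hε : (0 : ℝ) < Real.log (4 / 3) / 4 := by positivity [Real.log_pos (by norm_num : (1 : ℝ) < 4 / 3)]
  have hev := (Metric.tendsto_atTop.1 h) _ hε
  obtain ⟨Y₀, hY₀⟩ := hev
  refine ⟨max (max Y₀ 3) (max Y₀ 3 ^ (4 / 3 : ℝ)), le_trans (by norm_num) ((le_max_right _ _).trans (le_max_left _ _)), ?_⟩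
  intro y hy
  have hY3 : max Y₀ 3 ≤ y := (le_max_left _ _).trans hy
  have hy3 : 3 ≤ y := (le_max_right _ _).trans hY3
  have hy0 : 0 < y := by linarith
  have hlogy : 0 < Real.log y := Real.log_pos (by linarith)
  set y' : ℝ := y ^ (3 / 4 : ℝ) with hy'
  have hy'ge : max Y₀ 3 ≤ y' := by
    have h1 : max Y₀ 3 ^ (4 / 3 : ℝ) ≤ y := (le_max_right _ _).trans hy
    have h0 : 0 ≤ max Y₀ 3 := le_trans (by norm_num) (le_max_right _ _)
    calc max Y₀ 3 = (max Y₀ 3 ^ (4 / 3 : ℝ)) ^ (3 / 4 : ℝ) := by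
          rw [← Real.rpow_mul h0]; norm_num
      _ ≤ y ^ (3 / 4 : ℝ) := Real.rpow_le_rpow (by positivity) h1 (by norm_num)
  have h1 := hY₀ y ((le_max_left _ _).trans hY3)
  have h2 := hY₀ y' ((le_max_left _ _).trans hy'ge)
  rw [Real.dist_eq] at h1 h2
  have hloglog : Real.log (Real.log y') = Real.log (3 / 4) + Real.log (Real.log y) := by
    rw [hy', Real.log_rpow hy0, Real.log_mul (by norm_num) hlogy.ne']
  have h43 : Real.log (4 / 3 : ℝ) = -Real.log (3 / 4) := by
    rw [← Real.log_inv]; norm_num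
  rw [abs_lt] at h1 h2
  linarith [h1.1, h1.2, h2.1, h2.2]

/-- `4k + 2 ≤ 4^k` for `k ≥ 2`. [folklore] -/
theorem four_mul_add_two_le_four_pow {k : ℕ} (hk : 2 ≤ k) : 4 * k + 2 ≤ 4 ^ k := by
  induction k, hk using Nat.le_induction with
  | base => norm_num
  | succ n hn ih =>
    calc 4 * (n + 1) + 2 ≤ 4 * (4 * n + 2) := by omega
      _ ≤ 4 * 4 ^ n := by omega
      _ = 4 ^ (n + 1) := by ring

/-- **The choice of `m`**: for `k ≥ 2` and `S ≥ 0`, `(kS/(8e))^k ≤ C(2k,k) 4^{-k} k! (S/2)^k / 2`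
(`C(2k,k) ≥ 4^k/(2k+1)`, `k! ≥ (k/e)^k`, `4k + 2 ≤ 4^k`). [folklore] -/
theorem pow_le_centralMoment {k : ℕ} (hk : 2 ≤ k) {S : ℝ} (hS : 0 ≤ S) :
    ((k : ℝ) * S / (8 * Real.exp 1)) ^ k ≤ ((2 * k).choose k : ℝ) / 4 ^ k * (k.factorial : ℝ) * (S / 2) ^ k / 2 := by
  have he : 0 < Real.exp 1 := Real.exp_pos 1
  have hk0 : (0 : ℝ) < k := by exact_mod_cast (show 0 < k by omega)
  -- `k! ≥ k^k / e^k`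
  have hfact : (k : ℝ) ^ k / Real.exp 1 ^ k ≤ (k.factorial : ℝ) := by
    have h := Real.pow_div_factorial_le_exp (x := (k : ℝ)) hk0.le k
    rw [div_le_iff₀ (by positivity)] at h
    rw [div_le_iff₀ (by positivity)]
    have he1 : Real.exp (k : ℝ) = Real.exp 1 ^ k := by rw [← Real.exp_one_rpow, Real.rpow_natCast]
    calc (k : ℝ) ^ k ≤ Real.exp (k : ℝ) * k.factorial := h
      _ = (k.factorial : ℝ) * Real.exp 1 ^ k := by rw [he1]; ring
  -- `C(2k,k)/4^k ≥ 1/(2k+1)`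
  have hbin : 1 / (2 * (k : ℝ) + 1) ≤ ((2 * k).choose k : ℝ) / 4 ^ k := by
    have h := Nat.four_pow_le_two_mul_add_one_mul_central_binom k
    rw [div_le_div_iff₀ (by positivity) (by positivity), one_mul, mul_comm]
    exact_mod_cast h
  -- `4k+2 ≤ 4^k`
  have h4 : 4 * (k : ℝ) + 2 ≤ 4 ^ k := by exact_mod_cast four_mul_add_two_le_four_pow hk
  -- combine
  have hpos1 : 0 < 2 * (k : ℝ) + 1 := by positivity
  have e1 : (k : ℝ) * S / (8 * Real.exp 1) = ((k : ℝ) / Real.exp 1) * (S / 2) * (1 / 4) := by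
    field_simp; ring
  calc ((k : ℝ) * S / (8 * Real.exp 1)) ^ k
      = ((k : ℝ) ^ k / Real.exp 1 ^ k) * (S / 2) ^ k * (1 / 4 ^ k) := by
        rw [e1, mul_pow, mul_pow, div_pow, one_div_pow]
    _ ≤ (k.factorial : ℝ) * (S / 2) ^ k * (1 / (2 * (2 * (k : ℝ) + 1))) := by
        refine mul_le_mul (mul_le_mul_of_nonneg_right hfact (by positivity)) ?_ (by positivity) (by positivity)
        exact div_le_div_of_nonneg_left zero_le_one (by positivity) (by linarith)
    _ = 1 / (2 * (k : ℝ) + 1) * (k.factorial : ℝ) * (S / 2) ^ k / 2 := by field_simp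
    _ ≤ _ := by
        have h0 : 0 ≤ (k.factorial : ℝ) * (S / 2) ^ k / 2 := by positivity
        calc 1 / (2 * (k : ℝ) + 1) * (k.factorial : ℝ) * (S / 2) ^ k / 2
            = 1 / (2 * (k : ℝ) + 1) * ((k.factorial : ℝ) * (S / 2) ^ k / 2) := by ring
          _ ≤ ((2 * k).choose k : ℝ) / 4 ^ k * ((k.factorial : ℝ) * (S / 2) ^ k / 2) :=
              mul_le_mul_of_nonneg_right hbin h0
          _ = _ := by ring

/-- `log x ≤ 12 x^{1/12}` for `x ≥ 0`. [folklore] -/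
theorem log_le_twelve_rpow {x : ℝ} (hx : 0 ≤ x) : Real.log x ≤ 12 * x ^ (1 / 12 : ℝ) := by
  have h := Real.log_le_rpow_div hx (by norm_num : (0 : ℝ) < 1 / 12)
  linarith [show x ^ (1 / 12 : ℝ) / (1 / 12) = 12 * x ^ (1 / 12 : ℝ) by ring]

end Toolbox

/-! ## F2: arithmetic of the parameter choice (small lemmas, to keep the final proof light) -/

section Arith

/-- Arithmetic for the parameter choice: `L² ≤ 36864 u²` when `1 ≤ L ≤ 192 u`. [folklore] -/
theorem arith_L_sq {L u : ℝ} (hL1 : 1 ≤ L) (hLu : L ≤ 192 * u) : L ^ 2 ≤ 36864 * u ^ 2 := by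
  nlinarith

/-- Arithmetic for the parameter choice: `c_k u⁸/L² ≥ 2` for `u` large. [folklore] -/
theorem arith_kr_two {ck u L : ℝ} (hck : 0 < ck) (hU : 73728 / ck ≤ u) (hu1 : 1 ≤ u) (hL0 : 0 < L)
    (hL2 : L ^ 2 ≤ 36864 * u ^ 2) : 2 ≤ ck * u ^ 8 / L ^ 2 := by
  rw [le_div_iff₀ (by positivity)]
  have h1 : 73728 / ck * u ^ 2 ≤ u ^ 8 := by
    calc 73728 / ck * u ^ 2 ≤ u * u ^ 2 := mul_le_mul_of_nonneg_right hU (by positivity)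
      _ = u ^ 3 := by ring
      _ ≤ u ^ 8 := pow_le_pow_right₀ hu1 (by norm_num)
  have h2 : 73728 * u ^ 2 ≤ ck * u ^ 8 := by
    have := mul_le_mul_of_nonneg_left h1 hck.le
    rwa [← mul_assoc, mul_div_cancel₀ _ hck.ne'] at this
  nlinarith

/-- Arithmetic for the parameter choice: `k ≥ (c_k/73728) u⁶`. [folklore] -/
theorem arith_k_ge {ck u L k : ℝ} (hck : 0 < ck) (hu : 0 < u) (hL0 : 0 < L) (hL2 : L ^ 2 ≤ 36864 * u ^ 2)
    (hk : ck * u ^ 8 / L ^ 2 / 2 ≤ k) : ck / 73728 * u ^ 6 ≤ k := by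
  refine le_trans ?_ hk
  rw [le_div_iff₀ (by norm_num), le_div_iff₀ (by positivity)]
  calc ck / 73728 * u ^ 6 * 2 * L ^ 2 ≤ ck / 73728 * u ^ 6 * 2 * (36864 * u ^ 2) := by gcongr
    _ = ck * u ^ 8 := by ring

/-- Arithmetic for the parameter choice: `(2k+1)L ≤ A u¹²`. [folklore] -/
theorem arith_kL {ck u L A k : ℝ} (hA : 0 < A) (hck : 0 < ck) (hu1 : 1 ≤ u) (hL1 : 1 ≤ L)
    (hk1 : 1 ≤ k) (hk : k ≤ ck * u ^ 8 / L ^ 2) (hU : 3 * ck / A ≤ u) :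
    (2 * k + 1) * L ≤ A * u ^ 12 := by
  have hL0 : 0 < L := by linarith
  have h1 : (2 * k + 1) * L ≤ 3 * (ck * u ^ 8 / L ^ 2) * L := by nlinarith
  have h2 : 3 * (ck * u ^ 8 / L ^ 2) * L = 3 * ck * u ^ 8 / L := by field_simp
  have h3 : 3 * ck * u ^ 8 / L ≤ 3 * ck * u ^ 8 := div_le_self (by positivity) hL1
  have h4 : 3 * ck / A * u ^ 8 ≤ u ^ 12 := by
    calc 3 * ck / A * u ^ 8 ≤ u * u ^ 8 := mul_le_mul_of_nonneg_right hU (by positivity)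
      _ = u ^ 9 := by ring
      _ ≤ u ^ 12 := pow_le_pow_right₀ hu1 (by norm_num)
  have h5 : 3 * ck * u ^ 8 ≤ A * u ^ 12 := by
    rw [div_mul_eq_mul_div, div_le_iff₀ hA] at h4; linarith
  linarith

/-- Arithmetic for the parameter choice: `(k-1)μ ≤ s₀/2`. [folklore] -/
theorem arith_kμ {ck u k bM s₀ : ℝ} (hck : 0 < ck) (hs₀ : 0 < s₀) (hu : 0 < u) (hk : k ≤ ck * u ^ 8)
    (hU : 2 * ck * bM ^ 2 / s₀ ≤ u) : (k - 1) * (bM ^ 2 / u ^ 9) ≤ s₀ / 2 := by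
  have h1 : (k - 1) * (bM ^ 2 / u ^ 9) ≤ ck * u ^ 8 * (bM ^ 2 / u ^ 9) :=
    mul_le_mul_of_nonneg_right (by linarith) (by positivity)
  have h2 : ck * u ^ 8 * (bM ^ 2 / u ^ 9) = ck * bM ^ 2 / u := by field_simp
  have h3 : ck * bM ^ 2 / u ≤ s₀ / 2 := by
    rw [div_le_iff₀ hu]
    rw [div_le_iff₀ hs₀] at hU
    linarith
  linarith

/-- Arithmetic for the parameter choice: `m ≥ c_m u⁴/L`. [folklore] -/
theorem arith_m_ge {ck s₀ e u L kr k S' : ℝ} (hck : 0 < ck) (hs₀ : 0 < s₀) (he : 0 < e) (hu : 0 < u) (hL : 0 < L)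
    (hkr : kr = ck * u ^ 8 / L ^ 2) (hk : kr / 2 ≤ k) (hk0 : 0 ≤ k) (hS : s₀ ≤ S') :
    Real.sqrt (ck * s₀ / (16 * e)) * u ^ 4 / L ≤ Real.sqrt (k * S' / (8 * e)) := by
  have h1 : Real.sqrt (ck * s₀ / (16 * e)) * u ^ 4 / L = Real.sqrt (ck * s₀ / (16 * e) * (u ^ 4 / L) ^ 2) := by
    rw [Real.sqrt_mul (by positivity), Real.sqrt_sq (by positivity)]; ring
  rw [h1]
  refine Real.sqrt_le_sqrt ?_
  have h2 : ck * s₀ / (16 * e) * (u ^ 4 / L) ^ 2 = (kr / 2) * s₀ / (8 * e) := by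
    rw [hkr]; field_simp; ring
  rw [h2]
  exact div_le_div_of_nonneg_right (mul_le_mul hk hS hs₀.le hk0) (by positivity)

/-- Arithmetic for the parameter choice: `c_m u³/192 ≤ c_m u⁴/L`. [folklore] -/
theorem arith_cm_u3 {cm u L : ℝ} (hcm : 0 < cm) (hu : 0 < u) (hL0 : 0 < L) (hLu : L ≤ 192 * u) :
    cm / 192 * u ^ 3 ≤ cm * u ^ 4 / L := by
  rw [div_mul_eq_mul_div, div_le_div_iff₀ (by norm_num) hL0]
  calc cm * u ^ 3 * L ≤ cm * u ^ 3 * (192 * u) := mul_le_mul_of_nonneg_left hLu (by positivity)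
    _ = cm * u ^ 4 * 192 := by ring

/-- Arithmetic for the parameter choice: the logarithm of the prime-moment error is `≤ a₁₃ u⁹`. [folklore] -/
theorem arith_master_log {F₀ cX ck u k : ℝ} (hck : 0 < ck) (hu1 : 1 ≤ u)
    (hk0 : 0 ≤ k) (hk : k ≤ ck * u ^ 8) :
    (Real.log F₀ + 96 * Real.log u) + k * (Real.log cX + 192 * Real.log u) ≤
      (|Real.log F₀| + 97 + ck * (|Real.log cX| + 192)) * u ^ 9 := by
  have hu : 0 < u := by linarith
  have hlogu : Real.log u ≤ u := (Real.log_le_sub_one_of_pos hu).trans (by linarith)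
  have hlogu0 : 0 ≤ Real.log u := Real.log_nonneg hu1
  have hu9 : (1 : ℝ) ≤ u ^ 9 := one_le_pow₀ hu1
  have hu19 : u ≤ u ^ 9 := by
    calc u = u ^ 1 := (pow_one u).symm
      _ ≤ u ^ 9 := pow_le_pow_right₀ hu1 (by norm_num)
  have hu89 : u ^ 8 ≤ u ^ 9 := pow_le_pow_right₀ hu1 (by norm_num)
  have hu8 : 0 ≤ u ^ 8 := by positivity
  have hA := le_abs_self (Real.log F₀)
  have hB := le_abs_self (Real.log cX)
  have hA0 := abs_nonneg (Real.log F₀)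
  have hB0 := abs_nonneg (Real.log cX)
  -- `k (log cX + 192 log u) ≤ ck u⁸ (|log cX| + 192 u)`
  have h1 : k * (Real.log cX + 192 * Real.log u) ≤ ck * u ^ 8 * (|Real.log cX| + 192 * u) := by
    have h2 : Real.log cX + 192 * Real.log u ≤ |Real.log cX| + 192 * u := by linarith
    calc k * (Real.log cX + 192 * Real.log u) ≤ k * (|Real.log cX| + 192 * u) :=
          mul_le_mul_of_nonneg_left h2 hk0
      _ ≤ ck * u ^ 8 * (|Real.log cX| + 192 * u) := mul_le_mul_of_nonneg_right hk (by positivity)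
  have h3 : ck * u ^ 8 * (|Real.log cX| + 192 * u) = ck * |Real.log cX| * u ^ 8 + 192 * ck * u ^ 9 := by ring
  have h4 : ck * |Real.log cX| * u ^ 8 ≤ ck * |Real.log cX| * u ^ 9 :=
    mul_le_mul_of_nonneg_left hu89 (by positivity)
  have h5 : |Real.log F₀| ≤ |Real.log F₀| * u ^ 9 := le_mul_of_one_le_right hA0 hu9
  have h6 : 96 * Real.log u ≤ 96 * u ^ 9 := by linarith
  have h7 : (0 : ℝ) ≤ u ^ 9 := by positivity
  nlinarith

/-- Arithmetic for the parameter choice: `8 b u⁹⁶/s + 2 ≤ (8b/s + 2) u⁹⁶` for `u ≥ 1`. [folklore] -/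
theorem arith_F₀_le {b sq u : ℝ} (hu1 : 1 ≤ u) :
    8 * b * u ^ 96 / sq + 2 ≤ (8 * b / sq + 2) * u ^ 96 := by
  have hu96 : (1 : ℝ) ≤ u ^ 96 := one_le_pow₀ hu1
  rw [add_mul, div_mul_eq_mul_div]
  linarith

/-- Arithmetic for the parameter choice: `log(K+1) + B log log T ≤ k`. [folklore] -/
theorem arith_logQ {K B LL u ck k : ℝ} (hB : 0 ≤ B) (hLLu : LL ≤ 12 * u) (hu1 : 1 ≤ u)
    (hck : 0 < ck) (hU : 73728 * (|Real.log (K + 1)| + 12 * B) / ck ≤ u) (hk : ck / 73728 * u ^ 6 ≤ k) :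
    Real.log (K + 1) + B * LL ≤ k := by
  have hu : 0 < u := by linarith
  have h1 : Real.log (K + 1) + B * LL ≤ |Real.log (K + 1)| + 12 * B * u := by
    nlinarith [le_abs_self (Real.log (K + 1)), mul_le_mul_of_nonneg_left hLLu hB]
  have h2 : (|Real.log (K + 1)| + 12 * B) * u ≤ ck / 73728 * u ^ 6 := by
    have h4 : 73728 * (|Real.log (K + 1)| + 12 * B) / ck ≤ u ^ 5 :=
      hU.trans (by calc u = u ^ 1 := (pow_one u).symm
        _ ≤ u ^ 5 := pow_le_pow_right₀ hu1 (by norm_num))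
    rw [div_le_iff₀ hck] at h4
    nlinarith
  have h3 : |Real.log (K + 1)| + 12 * B * u ≤ (|Real.log (K + 1)| + 12 * B) * u := by
    nlinarith [abs_nonneg (Real.log (K + 1))]
  linarith

/-- Arithmetic for the parameter choice: `8e ≤ m`. [folklore] -/
theorem arith_8e_le_m {e s₀ k S' m u ck : ℝ} (he : 2.7 < e ∧ e < 2.72) (hs₀ : 0 < s₀) (hS : s₀ ≤ S') (hk0 : 0 ≤ k)
    (hm0 : 0 ≤ m) (hm2 : m ^ 2 = k * S' / (8 * e)) (hu1 : 1 ≤ u) (hck : 0 < ck)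
    (hU : 73728 * 10752 / (s₀ * ck) ≤ u) (hk : ck / 73728 * u ^ 6 ≤ k) : 8 * e ≤ m := by
  have he0 : 0 < e := by linarith [he.1]
  have hu : 0 < u := by linarith
  have hk10752 : 10752 / s₀ ≤ k := by
    have h1 : 73728 * 10752 / (s₀ * ck) * u ^ 5 ≤ u ^ 6 := by
      calc 73728 * 10752 / (s₀ * ck) * u ^ 5 ≤ u * u ^ 5 := mul_le_mul_of_nonneg_right hU (by positivity)
        _ = u ^ 6 := by ring
    have h2 : 10752 / s₀ * u ^ 5 ≤ ck / 73728 * u ^ 6 := by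
      have := mul_le_mul_of_nonneg_left h1 (show 0 ≤ ck / 73728 by positivity)
      refine le_trans (le_of_eq ?_) this
      field_simp
    have hu5 : (1 : ℝ) ≤ u ^ 5 := one_le_pow₀ hu1
    have : 10752 / s₀ ≤ 10752 / s₀ * u ^ 5 := le_mul_of_one_le_right (by positivity) hu5
    linarith
  have h64 : (8 * e) ^ 2 ≤ m ^ 2 := by
    rw [hm2, le_div_iff₀ (by positivity)]
    have h1 : 10752 ≤ k * s₀ := by rw [div_le_iff₀ hs₀] at hk10752; linarith
    have h2 : k * s₀ ≤ k * S' := mul_le_mul_of_nonneg_left hS hk0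
    nlinarith [he.1, he.2]
  exact le_of_pow_le_pow_left₀ two_ne_zero hm0 h64

/-- Arithmetic for the parameter choice: `8e X₂ ≤ m` (this is where `c_k` is chosen). [folklore] -/
theorem arith_X₂ {K L ν k kr ck u ℓ e s₀ cm m : ℝ} (hK : 0 < K) (hL1 : 1 ≤ L) (hν : ν ≤ 3 * k) (hν0 : 0 ≤ ν)
    (hkkr : k ≤ kr) (hkr : kr = ck * u ^ 8 / L ^ 2) (hℓ : ℓ = u ^ 12) (hu : 0 < u) (he : 0 < e)
    (hs₀ : 0 < s₀) (hck0 : 0 < ck) (hck1 : ck ≤ 1) (hck2 : ck ≤ Real.sqrt (s₀ / (16 * e)) / (72 * e * K))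
    (hcm : cm = Real.sqrt (ck * s₀ / (16 * e))) (hm : cm * u ^ 4 / L ≤ m) :
    8 * e * (K * L ^ 2 * ν ^ 2 / ℓ) ≤ m := by
  have hL0 : 0 < L := by linarith
  -- `X₂ ≤ 9 K ck² u⁴ / L²`
  have h1 : K * L ^ 2 * ν ^ 2 / ℓ ≤ 9 * K * ck ^ 2 * u ^ 4 / L ^ 2 := by
    have hν2 : ν ^ 2 ≤ 9 * kr ^ 2 := by nlinarith
    rw [hℓ, div_le_div_iff₀ (by positivity) (by positivity)]
    have hkr' : kr * L ^ 2 = ck * u ^ 8 := by rw [hkr]; field_simp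
    have : K * L ^ 2 * ν ^ 2 * L ^ 2 ≤ K * L ^ 2 * (9 * kr ^ 2) * L ^ 2 := by gcongr
    calc K * L ^ 2 * ν ^ 2 * L ^ 2 ≤ K * L ^ 2 * (9 * kr ^ 2) * L ^ 2 := this
      _ = 9 * K * (kr * L ^ 2) ^ 2 := by ring
      _ = 9 * K * ck ^ 2 * u ^ 4 * u ^ 12 := by rw [hkr']; ring
  -- `72 e K ck² ≤ cm`
  have hsq : 72 * e * K * ck ≤ Real.sqrt (s₀ / (16 * e)) := by
    rw [le_div_iff₀ (by positivity)] at hck2; linarith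
  have hck_sqrt : ck ≤ Real.sqrt ck := by
    rw [Real.le_sqrt hck0.le hck0.le]; nlinarith
  have h2 : 72 * e * K * ck ^ 2 ≤ cm := by
    rw [hcm, show ck * s₀ / (16 * e) = ck * (s₀ / (16 * e)) by ring, Real.sqrt_mul hck0.le]
    calc 72 * e * K * ck ^ 2 = (72 * e * K * ck) * ck := by ring
      _ ≤ Real.sqrt (s₀ / (16 * e)) * ck := mul_le_mul_of_nonneg_right hsq hck0.le
      _ ≤ Real.sqrt (s₀ / (16 * e)) * Real.sqrt ck := mul_le_mul_of_nonneg_left hck_sqrt (Real.sqrt_nonneg _)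
      _ = Real.sqrt ck * Real.sqrt (s₀ / (16 * e)) := by ring
  -- combine
  calc 8 * e * (K * L ^ 2 * ν ^ 2 / ℓ) ≤ 8 * e * (9 * K * ck ^ 2 * u ^ 4 / L ^ 2) :=
        mul_le_mul_of_nonneg_left h1 (by positivity)
    _ = (72 * e * K * ck ^ 2) * u ^ 4 / L ^ 2 := by ring
    _ ≤ cm * u ^ 4 / L ^ 2 := by gcongr
    _ ≤ cm * u ^ 4 / L := by
        rw [hcm] at *
        refine div_le_div_of_nonneg_left (by positivity) hL0 ?_
        nlinarith
    _ ≤ m := hm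

/-- Arithmetic for the parameter choice: the prime-power error is `≤ 12960 (∫φ) u²`. [folklore] -/
theorem arith_E₁ {bM NL L LL u : ℝ} (hbM : 0 < bM) (hNL : NL ≤ 8 * LL) (hNL0 : 0 ≤ NL) (hL : L = 16 * LL)
    (hLL1 : 1 ≤ LL) (hLLu : LL ≤ 12 * u) :
    2 * bM * (NL + 1) * (1 + L / 4) ≤ 12960 * bM * u ^ 2 := by
  rw [hL]
  have h1 : (NL + 1) * (1 + 16 * LL / 4) ≤ 45 * LL ^ 2 := by nlinarith
  have h2 : LL ^ 2 ≤ 144 * u ^ 2 := by nlinarith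
  nlinarith

/-- Arithmetic for the parameter choice: the `O(1/T)` terms are `≤ 1`. [folklore] -/
theorem arith_frac {C L ℓ u bM Abs T lT2 : ℝ} (hC : 0 < C) (hbM : 0 < bM) (hu1 : 1 ≤ u)
    (hLu : L ≤ 192 * u) (hℓ : ℓ = u ^ 12) (hAbs : Abs ≤ 2 * bM * u ^ 48)
    (hlT2 : 0 ≤ lT2) (hlT2' : lT2 ≤ 2 * ℓ) (hT : u ^ 108 / 362880 ≤ T) (hT0 : 0 < T)
    (hU : 362880 * (384 * C + 16 * bM) ≤ u) :
    (C * L * ℓ ^ 2 * lT2 + 8 * ℓ ^ 4 * Abs) / T ≤ 1 := by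
  have hu : 0 < u := by linarith
  rw [div_le_one hT0]
  have h1 : C * L * ℓ ^ 2 * lT2 ≤ 384 * C * u ^ 37 := by
    rw [hℓ] at hlT2' ⊢
    calc C * L * (u ^ 12) ^ 2 * lT2 ≤ C * (192 * u) * (u ^ 12) ^ 2 * (2 * u ^ 12) := by gcongr
      _ = 384 * C * u ^ 37 := by ring
  have h2 : 8 * ℓ ^ 4 * Abs ≤ 16 * bM * u ^ 96 := by
    rw [hℓ]
    calc 8 * (u ^ 12) ^ 4 * Abs ≤ 8 * (u ^ 12) ^ 4 * (2 * bM * u ^ 48) := by gcongr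
      _ = 16 * bM * u ^ 96 := by ring
  have h3 : u ^ 37 ≤ u ^ 96 := pow_le_pow_right₀ hu1 (by norm_num)
  have h4 : (384 * C + 16 * bM) * u ^ 96 ≤ u ^ 108 / 362880 := by
    rw [le_div_iff₀ (by norm_num)]
    calc (384 * C + 16 * bM) * u ^ 96 * 362880 = 362880 * (384 * C + 16 * bM) * u ^ 96 := by ring
      _ ≤ u * u ^ 96 := mul_le_mul_of_nonneg_right hU (by positivity)
      _ = u ^ 97 := by ring
      _ ≤ u ^ 108 := pow_le_pow_right₀ hu1 (by norm_num)
  nlinarith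

/-- Arithmetic for the parameter choice: the rate `(log T')^{1/3}/log log T'` against `m/(4 m₀)`. [folklore] -/
theorem arith_rate {cr m m₀ cm u L LL lT' : ℝ} (hcr : cr = cm / (64 * m₀)) (hm₀ : 0 < m₀) (hcm : 0 < cm) (hu : 0 < u)
    (hL : L = 16 * LL) (hLL : 0 < LL) (hm : cm * u ^ 4 / L ≤ m) (hnum : lT' ^ (1 / 3 : ℝ) ≤ u ^ 4)
    (hden : LL / 2 ≤ Real.log lT') :
    cr / 2 * (lT' ^ (1 / 3 : ℝ) / Real.log lT') ≤ m / (4 * m₀) := by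
  have hlog0 : 0 < Real.log lT' := by linarith
  have h1 : lT' ^ (1 / 3 : ℝ) / Real.log lT' ≤ u ^ 4 / (LL / 2) :=
    div_le_div₀ (by positivity) hnum (by positivity) hden
  calc cr / 2 * (lT' ^ (1 / 3 : ℝ) / Real.log lT') ≤ cr / 2 * (u ^ 4 / (LL / 2)) :=
        mul_le_mul_of_nonneg_left h1 (by rw [hcr]; positivity)
    _ = (cm * u ^ 4 / L) / (4 * m₀) := by rw [hcr, hL]; field_simp; ring
    _ ≤ m / (4 * m₀) := div_le_div_of_nonneg_right hm (by positivity)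

end Arith

/-! ## F2: the conditional discharge -/

section FinalAssembly

set_option maxHeartbeats 1600000 in
/-- **Selberg's `Ω`-theorem for `S(t)` from a zero-density estimate near the critical line.**
If `N(σ, H) ≤ C_D H^{1 - A(σ - 1/2)} (log H)^B` for `1/2 ≤ σ ≤ 1`, `H ≥ 2` (some `A > 0`,
`B, C_D ≥ 0` — Selberg 1946, Thm 1 gives `A = 1/4`, `B = 1`; Titchmarsh §9.19), then
`S(t) = Ω_±((log t)^{1/3}/(log log t)^{7/3})` (`Selberg1946_zetaArgS_omega`); in fact the proof gives
the rate `(log T)^{1/3}/log log T` on every window `[T, 6T]` (Tsang 1986, Thm 3 shape, through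
`Selberg1946_zetaArgS_omega_of_local_weak`). Parameters: `L = 16 log log T` (so the loud primes
`p ≤ e^{L/16} = log T` carry `g_L(log p) ≥ 1/16`), `k ≍ (log T)^{2/3}/L²`, `P' = ` the primes in
`((log T)^{3/4}, log T]` (Mertens), `m = √(kS'/(8e))`; the parametric core is
`exists_zetaArgS_large_of_params`. This is the whole of Tsang's argument (§3) with Selberg's
density theorem as the only input not proved here. [cite: Tsang1986, Thm 3 and §3] -/
theorem Selberg1946_zetaArgS_omega_of_zeroDensity {A B Cd : ℝ} (hA : 0 < A) (hB : 0 ≤ B) (hCd : 0 ≤ Cd)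
    (hDen : ∀ σ H : ℝ, 1 / 2 ≤ σ → σ ≤ 1 → 2 ≤ H →
      (zetaZeroCountRe σ H : ℝ) ≤ Cd * H ^ (1 - A * (σ - 1 / 2)) * Real.log H ^ B) :
    Selberg1946_zetaArgS_omega := by
  classical
  obtain ⟨K, hK0, C, hC0, T₀, hT₀4, hcore⟩ := exists_zetaArgS_large_of_params hA hB hCd hDen
  obtain ⟨y₀, hy₀1, hMert⟩ := exists_primeRecipSum_window_ge
  -- absolute constants
  have hbM : 0 < bumpMass := bumpMass_pos
  set m₀ : ℝ := 2 * π * (g0 0).re with hm₀def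
  have hm₀ : 0 < m₀ := by positivity [g0_zero_re_pos]
  set s₀ : ℝ := Real.log (4 / 3) / 2 / 256 with hs₀def
  have hlog43 : 0 < Real.log (4 / 3 : ℝ) := Real.log_pos (by norm_num)
  have hs₀ : 0 < s₀ := by positivity
  have he : 0 < Real.exp 1 := Real.exp_pos 1
  have he27 : 2.7 < Real.exp 1 ∧ Real.exp 1 < 2.72 :=
    ⟨by linarith only [Real.exp_one_gt_d9], by linarith only [Real.exp_one_lt_d9]⟩
  set q : ℝ := s₀ / (4 * Real.exp 1) with hqdef
  have hq : 0 < q := by positivity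
  have hsq : 0 < Real.sqrt q := Real.sqrt_pos.2 hq
  set ck : ℝ := min 1 (Real.sqrt (s₀ / (16 * Real.exp 1)) / (72 * Real.exp 1 * K)) with hckdef
  have hck0 : 0 < ck := lt_min one_pos (by positivity)
  have hck1 : ck ≤ 1 := min_le_left _ _
  have hck2 : ck ≤ Real.sqrt (s₀ / (16 * Real.exp 1)) / (72 * Real.exp 1 * K) := min_le_right _ _
  set cm : ℝ := Real.sqrt (ck * s₀ / (16 * Real.exp 1)) with hcmdef
  have hcm : 0 < cm := Real.sqrt_pos.2 (by positivity)
  set cX : ℝ := 4 * bumpMass ^ 2 / q with hcXdef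
  have hcX : 0 < cX := by positivity
  set F₁ : ℝ := 8 * bumpMass / Real.sqrt q + 2 with hF₁def
  have hF₁ : 0 < F₁ := by positivity
  set a₁₃ : ℝ := |Real.log F₁| + 97 + ck * (|Real.log cX| + 192) with ha₁₃def
  have ha₁₃0 : 0 ≤ a₁₃ := by positivity
  set cr : ℝ := cm / (64 * m₀) with hcrdef
  have hcr : 0 < cr := by positivity
  -- the threshold
  have hlogT₀ : 0 ≤ Real.log T₀ := Real.log_nonneg (by linarith only [hT₀4])
  have hU0c : (0 : ℝ) ≤ 73728 / ck := by positivity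
  have hU0d : (0 : ℝ) ≤ 3 * ck / A := by positivity
  have hU0e : (0 : ℝ) ≤ 2 * ck * bumpMass ^ 2 / s₀ := by positivity
  have hU0g : (0 : ℝ) ≤ 73728 * (|Real.log (K + 1)| + 12 * B) / ck := by positivity
  have hU0h : (0 : ℝ) ≤ 73728 * 10752 / (s₀ * ck) := by positivity
  have hU0i : (0 : ℝ) ≤ (103680 * bumpMass + 12) / (cm / 192) := by positivity
  have hU0j : (0 : ℝ) ≤ 362880 * (384 * C + 16 * bumpMass) := by positivity
  -- `U` is introduced as an opaque variable (a `set` would let tactics unfold it under `U ^ 12`)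
  obtain ⟨U, hUdef⟩ : ∃ U : ℝ, U = 4 + Real.log T₀ + y₀ + 192 + 73728 / ck + 3 * ck / A + 2 * ck * bumpMass ^ 2 / s₀ + a₁₃ +
    73728 * (|Real.log (K + 1)| + 12 * B) / ck + 73728 * 10752 / (s₀ * ck) +
    (103680 * bumpMass + 12) / (cm / 192) + 362880 * (384 * C + 16 * bumpMass) := ⟨_, rfl⟩
  have hU4 : 4 ≤ U := by
    rw [hUdef]; linarith only [hlogT₀, hy₀1, hU0c, hU0d, hU0e, ha₁₃0, hU0g, hU0h, hU0i, hU0j]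
  have hU1 : 1 ≤ U := by linarith only [hU4]
  have hUT₀ : Real.log T₀ ≤ U := by
    rw [hUdef]; linarith only [hlogT₀, hy₀1, hU0c, hU0d, hU0e, ha₁₃0, hU0g, hU0h, hU0i, hU0j]
  have hUy₀ : y₀ ≤ U := by
    rw [hUdef]; linarith only [hlogT₀, hy₀1, hU0c, hU0d, hU0e, ha₁₃0, hU0g, hU0h, hU0i, hU0j]
  have hU192 : 192 ≤ U := by
    rw [hUdef]; linarith only [hlogT₀, hy₀1, hU0c, hU0d, hU0e, ha₁₃0, hU0g, hU0h, hU0i, hU0j]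
  have hUck : 73728 / ck ≤ U := by
    rw [hUdef]; linarith only [hlogT₀, hy₀1, hU0c, hU0d, hU0e, ha₁₃0, hU0g, hU0h, hU0i, hU0j]
  have hUA : 3 * ck / A ≤ U := by
    rw [hUdef]; linarith only [hlogT₀, hy₀1, hU0c, hU0d, hU0e, ha₁₃0, hU0g, hU0h, hU0i, hU0j]
  have hUμ : 2 * ck * bumpMass ^ 2 / s₀ ≤ U := by
    rw [hUdef]; linarith only [hlogT₀, hy₀1, hU0c, hU0d, hU0e, ha₁₃0, hU0g, hU0h, hU0i, hU0j]
  have hUa₁₃ : a₁₃ ≤ U := by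
    rw [hUdef]; linarith only [hlogT₀, hy₀1, hU0c, hU0d, hU0e, ha₁₃0, hU0g, hU0h, hU0i, hU0j]
  have hUK : 73728 * (|Real.log (K + 1)| + 12 * B) / ck ≤ U := by
    rw [hUdef]; linarith only [hlogT₀, hy₀1, hU0c, hU0d, hU0e, ha₁₃0, hU0g, hU0h, hU0i, hU0j]
  have hUs : 73728 * 10752 / (s₀ * ck) ≤ U := by
    rw [hUdef]; linarith only [hlogT₀, hy₀1, hU0c, hU0d, hU0e, ha₁₃0, hU0g, hU0h, hU0i, hU0j]
  have hUE : (103680 * bumpMass + 12) / (cm / 192) ≤ U := by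
    rw [hUdef]; linarith only [hlogT₀, hy₀1, hU0c, hU0d, hU0e, ha₁₃0, hU0g, hU0h, hU0i, hU0j]
  have hUC : 362880 * (384 * C + 16 * bumpMass) ≤ U := by
    rw [hUdef]; linarith only [hlogT₀, hy₀1, hU0c, hU0d, hU0e, ha₁₃0, hU0g, hU0h, hU0i, hU0j]
  refine Selberg1946_zetaArgS_omega_of_local_weak ⟨cr / 2, by positivity, Real.exp (U ^ 12) / 2, fun T' hT' ↦ ?_⟩
  -- the height `T = 2T'` and `ℓ = log T = u¹²`
  set T : ℝ := 2 * T' with hTdef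
  have hTexp : Real.exp (U ^ 12) ≤ T := by rw [hTdef]; linarith only [hT']
  have hT0 : 0 < T := lt_of_lt_of_le (Real.exp_pos _) hTexp
  set ℓ : ℝ := Real.log T with hℓdef
  have hℓU : U ^ 12 ≤ ℓ := by rw [hℓdef, Real.le_log_iff_exp_le hT0]; exact hTexp
  have hU12 : U ≤ U ^ 12 := le_self_pow₀ hU1 (by norm_num)
  have hℓ4 : 4 ≤ ℓ := by linarith only [hℓU, hU12, hU4]
  have hℓ0 : 0 < ℓ := by linarith only [hℓ4]
  have hℓ1 : 1 ≤ ℓ := by linarith only [hℓ4]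
  have hTeq : Real.exp ℓ = T := by rw [hℓdef, Real.exp_log hT0]
  set u : ℝ := ℓ ^ (((12 : ℕ) : ℝ)⁻¹) with hudef
  have hu0 : 0 ≤ u := Real.rpow_nonneg hℓ0.le _
  have hu12 : u ^ 12 = ℓ := by rw [hudef, Real.rpow_inv_natCast_pow hℓ0.le (by norm_num)]
  have huU : U ≤ u := le_of_pow_le_pow_left₀ (by norm_num : (12 : ℕ) ≠ 0) hu0 (by rw [hu12]; exact hℓU)
  have hu4 : 4 ≤ u := hU4.trans huU
  have hu1 : 1 ≤ u := by linarith only [hu4]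
  have hupos : 0 < u := by linarith only [hu4]
  have hupow : ∀ {i j : ℕ}, i ≤ j → u ^ i ≤ u ^ j := fun h ↦ pow_le_pow_right₀ hu1 h
  have hdom : ∀ (a : ℝ) (j : ℕ), a ≤ u → j + 1 ≤ 12 → a * u ^ j ≤ u ^ 12 := fun a j ha hj ↦
    (mul_le_mul_of_nonneg_right ha (pow_nonneg hu0 _)).trans (by rw [← pow_succ']; exact hupow hj)
  -- `LL = log ℓ`, `L = 16 LL`
  set LL : ℝ := Real.log ℓ with hLLdef
  have hℓe : Real.exp 1 ≤ ℓ := by linarith only [he27.2, hℓ4]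
  have hLL1 : 1 ≤ LL := by rw [hLLdef, Real.le_log_iff_exp_le hℓ0]; exact hℓe
  have hLL0 : 0 < LL := by linarith only [hLL1]
  have hLLu : LL ≤ 12 * u := by
    have h := log_le_twelve_rpow hℓ0.le
    rwa [show (1 / 12 : ℝ) = ((12 : ℕ) : ℝ)⁻¹ by norm_num] at h
  have hexpLL : Real.exp LL = ℓ := by rw [hLLdef, Real.exp_log hℓ0]
  set L : ℝ := 16 * LL with hLdef
  have hL16 : 16 ≤ L := by rw [hLdef]; linarith only [hLL1]
  have hL1 : 1 ≤ L := by linarith only [hL16]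
  have hL0 : 0 < L := by linarith only [hL16]
  have hLu : L ≤ 192 * u := by rw [hLdef]; linarith only [hLLu]
  have hLℓ : L ≤ ℓ := by
    have h := hdom 192 1 (hU192.trans huU) (by norm_num)
    rw [pow_one, hu12] at h; linarith only [h, hLu]
  have hxr : Real.exp (L / 4) = ℓ ^ 4 := by
    rw [show L / 4 = (4 : ℕ) * LL by rw [hLdef]; push_cast; ring, Real.exp_nat_mul, hexpLL]
  have hL8 : Real.exp (L / 8) = ℓ ^ 2 := by
    rw [show L / 8 = (2 : ℕ) * LL by rw [hLdef]; push_cast; ring, Real.exp_nat_mul, hexpLL]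
  have hL16' : L / 16 = LL := by rw [hLdef]; ring
  have hℓ4u : ℓ ^ 4 = u ^ 48 := by rw [← hu12]; ring
  have hℓ2u : ℓ ^ 2 = u ^ 24 := by rw [← hu12]; ring
  -- (4) `e^{L/8} ≤ T^{1/4}`
  have hexpL : Real.exp (L / 8) ≤ T ^ (1 / 4 : ℝ) := by
    rw [Real.rpow_def_of_pos hT0, ← hℓdef, show L / 8 = 2 * LL by rw [hLdef]; ring, Real.exp_le_exp]
    have h := hdom 96 1 (le_trans (by norm_num) (hU192.trans huU)) (by norm_num)
    rw [pow_one, hu12] at h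
    linarith only [h, hLLu]
  -- `k`
  set kr : ℝ := ck * u ^ 8 / L ^ 2 with hkrdef
  have hkr0 : 0 ≤ kr := by positivity
  have hL2 : L ^ 2 ≤ 36864 * u ^ 2 := arith_L_sq hL1 hLu
  have hkr2 : 2 ≤ kr := arith_kr_two hck0 (hUck.trans huU) hu1 hL0 hL2
  have hkrle : kr ≤ ck * u ^ 8 := div_le_self (by positivity) (one_le_pow₀ hL1)
  set k : ℕ := ⌊kr⌋₊ with hkdef
  have hk2 : 2 ≤ k := Nat.le_floor (by exact_mod_cast hkr2)
  have hk1 : (1 : ℝ) ≤ k := by exact_mod_cast (show 1 ≤ k by omega)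
  have hk_le : (k : ℝ) ≤ kr := Nat.floor_le hkr0
  have hk_ge : kr / 2 ≤ k := by
    have := Nat.lt_floor_add_one kr; rw [← hkdef] at this; linarith only [this, hkr2]
  have hk0 : (0 : ℝ) < k := by linarith only [hk1]
  have hkck : (k : ℝ) ≤ ck * u ^ 8 := hk_le.trans hkrle
  have hk6 : ck / 73728 * u ^ 6 ≤ k := arith_k_ge hck0 hupos hL0 hL2 (by rw [← hkrdef]; exact hk_ge)
  have hν3k : ((2 * k + 1 : ℕ) : ℝ) ≤ 3 * k := by push_cast; linarith only [hk1]
  have hν0 : (0 : ℝ) ≤ ((2 * k + 1 : ℕ) : ℝ) := Nat.cast_nonneg _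
  have hkν : (k : ℝ) ≤ ((2 * k + 1 : ℕ) : ℝ) := by push_cast; linarith only [hk0]
  -- (6) `(2k+1) L ≤ A log T`
  have hkL : ((2 * k + 1 : ℕ) : ℝ) * L ≤ A * Real.log T := by
    have h := arith_kL hA hck0 hu1 hL1 hk1 hk_le (hUA.trans huU)
    rw [hu12] at h; push_cast; rw [← hℓdef]; exact h
  -- `P'`, `μ`, `S'`
  set P' : Finset ℕ := Nat.primesLE ⌊ℓ⌋₊ \ Nat.primesLE ⌊u ^ 9⌋₊ with hP'def
  set μ : ℝ := bumpMass ^ 2 / u ^ 9 with hμdef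
  have hμ0 : 0 ≤ μ := by positivity
  set S' : ℝ := ∑ p ∈ P', aCoef L p ^ 2 with hS'def
  have hS'0 : 0 ≤ S' := Finset.sum_nonneg fun p _ ↦ sq_nonneg _
  have hnCut : nCut L = ⌊ℓ ^ 4⌋₊ := by rw [nCut, hxr]
  have hℓℓ4 : ℓ ≤ ℓ ^ 4 := by
    calc ℓ = ℓ ^ 1 := (pow_one ℓ).symm
      _ ≤ ℓ ^ 4 := pow_le_pow_right₀ hℓ1 (by norm_num)
  have hP'sub : P' ⊆ primesP L := by
    intro p hp
    rw [hP'def, Finset.mem_sdiff, Nat.mem_primesLE] at hp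
    rw [mem_primesP, hnCut]
    exact ⟨hp.1.1.trans (Nat.floor_mono hℓℓ4), hp.1.2⟩
  have hP'mem : ∀ p ∈ P', p.Prime ∧ (p : ℝ) ≤ ℓ ∧ u ^ 9 < p := by
    intro p hp
    rw [hP'def, Finset.mem_sdiff, Nat.mem_primesLE, Nat.mem_primesLE, not_and'] at hp
    have hpr := hp.1.2
    refine ⟨hpr, (Nat.cast_le.2 hp.1.1).trans (Nat.floor_le hℓ0.le), ?_⟩
    have := hp.2 hpr
    push Not at this
    exact Nat.lt_of_floor_lt this
  have haμ : ∀ p ∈ P', aCoef L p ^ 2 ≤ μ := by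
    intro p hp
    obtain ⟨hpr, -, hpu⟩ := hP'mem p hp
    refine (aCoef_sq_le L hpr.pos).trans ?_
    rw [hμdef]
    exact div_le_div_of_nonneg_left (by positivity) (by positivity) hpu.le
  -- Mertens: `S' ≥ s₀`
  have hS's₀ : s₀ ≤ S' := by
    have hsub : Nat.primesLE ⌊u ^ 9⌋₊ ⊆ Nat.primesLE ⌊ℓ⌋₊ :=
      Nat.primesLE_mono (Nat.floor_mono (by rw [← hu12]; exact hupow (by norm_num)))
    have hsum : ∑ p ∈ P', (p : ℝ)⁻¹ = Mertens.primeRecipSum ℓ - Mertens.primeRecipSum (u ^ 9) := by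
      have h := Finset.sum_sdiff hsub (f := fun p : ℕ ↦ (p : ℝ)⁻¹)
      rw [Mertens.primeRecipSum, Mertens.primeRecipSum, ← h, hP'def]
      ring
    have hM := hMert ℓ ((hUy₀.trans huU).trans (by rw [← hu12]; exact le_self_pow₀ hu1 (by norm_num)))
    have h34 : ℓ ^ (3 / 4 : ℝ) = u ^ 9 := by
      rw [← hu12, ← Real.rpow_natCast u 12, ← Real.rpow_mul hu0]
      norm_num
    rw [h34, ← hsum] at hM
    have hterm : ∀ p ∈ P', (1 / 256) * (p : ℝ)⁻¹ ≤ aCoef L p ^ 2 := by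
      intro p hp
      obtain ⟨hpr, hpℓ, -⟩ := hP'mem p hp
      have h := aCoef_sq_ge hL0 hpr.pos (by
        rw [hL16', hLLdef]; exact Real.log_le_log (by exact_mod_cast hpr.pos) hpℓ)
      rw [one_div, ← mul_inv]; rw [one_div] at h; exact h
    calc s₀ = (1 / 256) * (Real.log (4 / 3) / 2) := by rw [hs₀def]; ring
      _ ≤ (1 / 256) * ∑ p ∈ P', (p : ℝ)⁻¹ := by gcongr
      _ = ∑ p ∈ P', (1 / 256) * (p : ℝ)⁻¹ := by rw [Finset.mul_sum]
      _ ≤ S' := Finset.sum_le_sum hterm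
  have hS'pos : 0 < S' := hs₀.trans_le hS's₀
  -- (10)
  have hkμ : ((k : ℝ) - 1) * μ ≤ S' / 2 :=
    (arith_kμ hck0 hs₀ hupos hkck (hUμ.trans huU)).trans (by linarith only [hS's₀])
  -- `m`, `Y`
  set m : ℝ := Real.sqrt (k * S' / (8 * Real.exp 1)) with hmdef
  have hm2 : m ^ 2 = k * S' / (8 * Real.exp 1) := Real.sq_sqrt (by positivity)
  have hm0 : 0 < m := Real.sqrt_pos.2 (by positivity)
  have hmpow : m ^ (2 * k) = ((k : ℝ) * S' / (8 * Real.exp 1)) ^ k := by rw [pow_mul, hm2]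
  set Y : ℝ := ((2 * k).choose k : ℝ) / 4 ^ k * (k.factorial : ℝ) * (S' / 2) ^ k / 2 with hYdef
  have hmY : m ^ (2 * k) ≤ Y := by rw [hmpow]; exact pow_le_centralMoment hk2 hS'0
  have hqm2 : q ≤ m ^ 2 := by
    rw [hm2, hqdef]
    have hk2' : (2 : ℝ) ≤ k := by exact_mod_cast hk2
    have h1 : 2 * s₀ ≤ k * S' := mul_le_mul hk2' hS's₀ hs₀.le hk0.le
    rw [div_le_div_iff₀ (by positivity) (by positivity)]
    calc s₀ * (8 * Real.exp 1) = 2 * s₀ * (4 * Real.exp 1) := by ring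
      _ ≤ k * S' * (4 * Real.exp 1) := mul_le_mul_of_nonneg_right h1 (by positivity)
  have hqY : q ^ k ≤ Y := by
    refine le_trans ?_ hmY
    rw [pow_mul]
    exact pow_le_pow_left₀ hq.le hqm2 k
  have hsqm : Real.sqrt q ≤ m := by
    have : Real.sqrt q ≤ Real.sqrt (m ^ 2) := Real.sqrt_le_sqrt hqm2
    rwa [Real.sqrt_sq hm0.le] at this
  have hm_ge : cm * u ^ 4 / L ≤ m := arith_m_ge hck0 hs₀ he hupos hL0 hkrdef hk_ge hk0.le hS's₀
  have hm_ge' : cm / 192 * u ^ 3 ≤ m := (arith_cm_u3 hcm hupos hL0 hLu).trans hm_ge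
  -- `Abs`, `xr`, and the master exponential inequality
  set Abs : ℝ := ∑ p ∈ primesP L, |aCoef L p| with hAbsdef
  have hAbs0 : 0 ≤ Abs := Finset.sum_nonneg fun p _ ↦ abs_nonneg _
  have hAbs : Abs ≤ 2 * bumpMass * u ^ 48 := by
    have h : Abs ≤ bumpMass * (Real.exp (L / 4) + 1) := sum_abs_aCoef_le L
    rw [hxr, hℓ4u] at h
    have h1 : (1 : ℝ) ≤ u ^ 48 := one_le_pow₀ hu1
    have h2 : bumpMass * (u ^ 48 + 1) ≤ bumpMass * (u ^ 48 + u ^ 48) :=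
      mul_le_mul_of_nonneg_left (by linarith only [h1]) hbM.le
    linarith only [h, h2]
  set Xb : ℝ := cX * u ^ 192 with hXbdef
  have hXb0 : 0 < Xb := by positivity
  have hmaster : (8 * bumpMass * u ^ 96 / Real.sqrt q + 2) * Xb ^ k ≤ T := by
    have hF0 : 0 < 8 * bumpMass * u ^ 96 / Real.sqrt q + 2 := by positivity
    rw [← hTeq, ← Real.exp_log hF0, ← Real.exp_log (pow_pos hXb0 k), ← Real.exp_add, Real.exp_le_exp, Real.log_pow,
      ← hu12]
    have h1 : Real.log (8 * bumpMass * u ^ 96 / Real.sqrt q + 2) ≤ Real.log F₁ + 96 * Real.log u := by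
      calc Real.log (8 * bumpMass * u ^ 96 / Real.sqrt q + 2) ≤ Real.log (F₁ * u ^ 96) :=
            Real.log_le_log hF0 (arith_F₀_le hu1)
        _ = Real.log F₁ + 96 * Real.log u := by
            rw [Real.log_mul hF₁.ne' (by positivity), Real.log_pow]; push_cast; ring
    have h2 : Real.log Xb = Real.log cX + 192 * Real.log u := by
      rw [hXbdef, Real.log_mul hcX.ne' (by positivity), Real.log_pow]; push_cast; ring
    have h3 : (Real.log F₁ + 96 * Real.log u) + k * (Real.log cX + 192 * Real.log u) ≤ a₁₃ * u ^ 9 :=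
      arith_master_log hck0 hu1 hk0.le hkck
    have h4 : a₁₃ * u ^ 9 ≤ u ^ 12 := hdom _ 9 (hUa₁₃.trans huU) (by norm_num)
    rw [h2]
    linarith only [h1, h3, h4]
  have hkey : (u ^ 48) ^ (2 * k) * (2 * bumpMass * u ^ 48) ^ (2 * k) = q ^ k * Xb ^ k := by
    rw [← mul_pow, ← mul_pow, pow_mul, hXbdef]
    congr 1
    rw [hcXdef]
    field_simp
    ring
  -- (13), (14)
  have hE1 : 2 * Real.exp (L / 4) ^ (2 * k) * Abs ^ (2 * k) ≤ T * Y := by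
    rw [hxr, hℓ4u]
    have h1 : Abs ^ (2 * k) ≤ (2 * bumpMass * u ^ 48) ^ (2 * k) := pow_le_pow_left₀ hAbs0 hAbs _
    have h2 : (2 : ℝ) ≤ 8 * bumpMass * u ^ 96 / Real.sqrt q + 2 := by
      linarith only [show 0 ≤ 8 * bumpMass * u ^ 96 / Real.sqrt q by positivity]
    calc 2 * (u ^ 48) ^ (2 * k) * Abs ^ (2 * k) ≤ 2 * (u ^ 48) ^ (2 * k) * (2 * bumpMass * u ^ 48) ^ (2 * k) :=
          mul_le_mul_of_nonneg_left h1 (by positivity)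
      _ = 2 * Xb ^ k * q ^ k := by rw [mul_assoc, hkey]; ring
      _ ≤ (8 * bumpMass * u ^ 96 / Real.sqrt q + 2) * Xb ^ k * q ^ k :=
          mul_le_mul_of_nonneg_right (mul_le_mul_of_nonneg_right h2 (by positivity)) (by positivity)
      _ ≤ T * Y := mul_le_mul hmaster hqY (by positivity) hT0.le
  have hE2 : 4 * Real.exp (L / 4) ^ (2 * k + 1) * Abs ^ (2 * k + 1) ≤ T * Y * m := by
    rw [hxr, hℓ4u]
    have h1 : Abs ^ (2 * k + 1) ≤ (2 * bumpMass * u ^ 48) ^ (2 * k + 1) := pow_le_pow_left₀ hAbs0 hAbs _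
    have h2 : 8 * bumpMass * u ^ 96 / Real.sqrt q ≤ 8 * bumpMass * u ^ 96 / Real.sqrt q + 2 := by linarith only []
    have hqk : 0 ≤ q ^ k * Real.sqrt q := by positivity
    calc 4 * (u ^ 48) ^ (2 * k + 1) * Abs ^ (2 * k + 1)
        ≤ 4 * (u ^ 48) ^ (2 * k + 1) * (2 * bumpMass * u ^ 48) ^ (2 * k + 1) :=
          mul_le_mul_of_nonneg_left h1 (by positivity)
      _ = (8 * bumpMass * u ^ 96) * ((u ^ 48) ^ (2 * k) * (2 * bumpMass * u ^ 48) ^ (2 * k)) := by ring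
      _ = (8 * bumpMass * u ^ 96 / Real.sqrt q) * Xb ^ k * (q ^ k * Real.sqrt q) := by
          rw [hkey]; field_simp
      _ ≤ (8 * bumpMass * u ^ 96 / Real.sqrt q + 2) * Xb ^ k * (q ^ k * Real.sqrt q) :=
          mul_le_mul_of_nonneg_right (mul_le_mul_of_nonneg_right h2 (by positivity)) hqk
      _ ≤ T * (Y * m) := mul_le_mul hmaster (mul_le_mul hqY hsqm hsq.le (le_trans (pow_nonneg hq.le _) hqY))
          hqk hT0.le
      _ = T * Y * m := by ring
  -- (15) `M₂ ≤ m/4`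
  set X₂ : ℝ := K * L ^ 2 * ((2 * k + 1 : ℕ) : ℝ) ^ 2 / Real.log T with hX₂def
  set Q : ℝ := (K * Real.log T ^ B + 1) ^ (((2 * k + 1 : ℕ) : ℝ)⁻¹) with hQdef
  have hb0 : 0 < K * Real.log T ^ B + 1 := by positivity
  have hQ0 : 0 ≤ Q := Real.rpow_nonneg hb0.le _
  have hQe : Q ≤ Real.exp 1 := by
    rw [hQdef, Real.rpow_def_of_pos hb0, Real.exp_le_exp, ← div_eq_mul_inv, div_le_one (by positivity)]
    rw [← hℓdef]
    have hℓB : 1 ≤ ℓ ^ B := Real.one_le_rpow hℓ1 hB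
    have h1 : Real.log (K * ℓ ^ B + 1) ≤ Real.log (K + 1) + B * LL := by
      have hle : K * ℓ ^ B + 1 ≤ (K + 1) * ℓ ^ B := by linarith only [hℓB]
      calc Real.log (K * ℓ ^ B + 1) ≤ Real.log ((K + 1) * ℓ ^ B) := Real.log_le_log (by rw [hℓdef]; exact hb0) hle
        _ = Real.log (K + 1) + B * LL := by
            rw [Real.log_mul (by positivity) (by positivity), Real.log_rpow hℓ0, hLLdef]
    have h2 := arith_logQ hB hLLu hu1 hck0 (hUK.trans huU) hk6
    linarith only [h1, h2, hkν]
  set M₂ : ℝ := 2 * max X₂ 1 * Q with hM₂def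
  have hmax0 : 0 ≤ max X₂ 1 := le_trans zero_le_one (le_max_right _ _)
  have hM₂m : M₂ ≤ m / 4 := by
    have hm8e : 8 * Real.exp 1 ≤ m := arith_8e_le_m he27 hs₀ hS's₀ hk0.le hm0.le hm2 hu1 hck0 (hUs.trans huU) hk6
    have hX₂m : 8 * Real.exp 1 * X₂ ≤ m :=
      arith_X₂ hK0 hL1 hν3k hν0 hk_le hkrdef hu12.symm hupos he hs₀ hck0 hck1 hck2 hcmdef hm_ge
    have hmax : 8 * Real.exp 1 * max X₂ 1 ≤ m := by
      rcases le_total X₂ 1 with h | h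
      · rw [max_eq_right h]; linarith only [hm8e]
      · rw [max_eq_left h]; exact hX₂m
    calc M₂ = 2 * max X₂ 1 * Q := rfl
      _ ≤ 2 * max X₂ 1 * Real.exp 1 := mul_le_mul_of_nonneg_left hQe (by positivity)
      _ = (8 * Real.exp 1 * max X₂ 1) / 4 := by ring
      _ ≤ m / 4 := by linarith only [hmax]
  have hM₂0 : 0 ≤ M₂ := by positivity
  have hM₂m' : M₂ ≤ m := by linarith only [hM₂m, hM₂0, hm0]
  -- (17) the main inequality, with `M₀ = m/(4 m₀)`
  set M₀ : ℝ := m / (4 * m₀) with hM₀def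
  have hM₀0 : 0 ≤ M₀ := by positivity
  have hE₁ : 2 * bumpMass * (Nat.log 2 (nCut L) + 1) * (1 + L / 4) ≤ 12960 * bumpMass * u ^ 2 := by
    have hNL : (Nat.log 2 (nCut L) : ℝ) ≤ 8 * LL := by
      have hlog : Real.log (nCut L : ℝ) ≤ 4 * LL := by
        rw [hnCut]
        rcases Nat.eq_zero_or_pos ⌊ℓ ^ 4⌋₊ with h0 | hpos
        · rw [h0]; simp; positivity
        · calc Real.log (⌊ℓ ^ 4⌋₊ : ℝ) ≤ Real.log (ℓ ^ 4) :=
              Real.log_le_log (by exact_mod_cast hpos) (Nat.floor_le (by positivity))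
            _ = 4 * LL := by rw [Real.log_pow, hLLdef]; push_cast; ring
      -- `Nat.log 2 n · log 2 ≤ log n`
      have hNL2 : (Nat.log 2 (nCut L) : ℝ) * Real.log 2 ≤ Real.log (nCut L) := by
        rcases Nat.eq_zero_or_pos (nCut L) with h0 | hn
        · rw [h0]; simp
        · have h := Nat.pow_log_le_self 2 hn.ne'
          have h' : (2 : ℝ) ^ Nat.log 2 (nCut L) ≤ nCut L := by exact_mod_cast h
          have h'' := Real.log_le_log (by positivity) h'
          rwa [Real.log_pow] at h''
      have hN0 : 0 ≤ (Nat.log 2 (nCut L) : ℝ) := Nat.cast_nonneg _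
      have hprod : (Nat.log 2 (nCut L) : ℝ) * 0.6931471803 ≤ (Nat.log 2 (nCut L) : ℝ) * Real.log 2 :=
        mul_le_mul_of_nonneg_left Real.log_two_gt_d9.le hN0
      linarith only [hlog, hNL2, hprod, hLL0]
    exact arith_E₁ hbM hNL (Nat.cast_nonneg _) hLdef hLL1 hLLu
  have hfrac : (C * L * Real.exp (L / 8) * Real.log (T + 2) + 8 * Real.exp (L / 4) * Abs + T * M₂) / T ≤ 1 + M₂ := by
    rw [hL8, hxr, add_div, mul_div_cancel_left₀ _ hT0.ne']
    have hT4 : 4 ≤ T := by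
      have := Real.add_one_le_exp ℓ; rw [hTeq] at this; linarith only [this, hℓ4]
    have hT2 : Real.log (T + 2) ≤ 2 * ℓ := by
      calc Real.log (T + 2) ≤ Real.log (T ^ 2) := Real.log_le_log (by linarith only [hT4]) (by nlinarith only [hT4])
        _ = 2 * ℓ := by rw [Real.log_pow, hℓdef]; push_cast; ring
    have hT108 : u ^ 108 / 362880 ≤ T := by
      have h := Real.pow_div_factorial_le_exp (x := u ^ 12) (by positivity) 9
      have hf : ((Nat.factorial 9 : ℕ) : ℝ) = 362880 := by norm_num [Nat.factorial]
      rw [hf, hu12, hTeq] at h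
      have e108 : u ^ 108 = ℓ ^ 9 := by rw [← hu12]; ring
      rw [e108]; exact h
    have h := arith_frac hC0 hbM hu1 hLu hu12.symm hAbs (Real.log_nonneg (by linarith only [hT4])) hT2 hT108 hT0
      (hUC.trans huU)
    linarith only [h]
  have hmain : M₀ * (2 * π * (g0 0).re) + 1 ≤ (m - M₂) - 2 * (2 * bumpMass * (Nat.log 2 (nCut L) + 1) * (1 + L / 4)) -
      (C * L * Real.exp (L / 8) * Real.log (T + 2) + 8 * Real.exp (L / 4) * Abs + T * M₂) / T := by
    have h1 : M₀ * (2 * π * (g0 0).re) = m / 4 := by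
      rw [hM₀def, ← hm₀def]; field_simp
    rw [h1]
    have h2 : 8 * (12960 * bumpMass * u ^ 2) + 12 ≤ m := by
      refine le_trans ?_ hm_ge'
      have h3 : (103680 * bumpMass + 12) / (cm / 192) * u ^ 2 ≤ u ^ 3 := by
        calc (103680 * bumpMass + 12) / (cm / 192) * u ^ 2 ≤ u * u ^ 2 :=
              mul_le_mul_of_nonneg_right (hUE.trans huU) (by positivity)
          _ = u ^ 3 := by ring
      have h4 := mul_le_mul_of_nonneg_left h3 (show 0 ≤ cm / 192 by positivity)
      rw [← mul_assoc, mul_div_cancel₀ _ (by positivity : cm / 192 ≠ 0)] at h4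
      have hu2 : (1 : ℝ) ≤ u ^ 2 := one_le_pow₀ hu1
      linarith only [h4, hu2]
    linarith only [hfrac, hE₁, hM₂m, h2]
  -- apply the parametric core
  have hTT₀ : T₀ ≤ T := by
    have h1 : Real.log T₀ ≤ ℓ := (hUT₀.trans huU).trans (by rw [← hu12]; exact le_self_pow₀ hu1 (by norm_num))
    rwa [hℓdef, Real.log_le_log_iff (by linarith only [hT₀4]) hT0] at h1
  have hres := hcore T hTT₀ L hL1 hLℓ hexpL k hk2 hkL P' μ m M₀ hP'sub hμ0 haμ
    hkμ hm0 hmY hE1 hE2 hM₂m' hM₀0 hmain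
  obtain ⟨⟨u₁, hu₁, hS₁⟩, ⟨u₂, hu₂, hS₂⟩⟩ := hres
  -- the rate
  have hT'pos : 0 < T' := by linarith only [hT', Real.exp_pos (U ^ 12)]
  have hlT' : Real.log T' = ℓ - Real.log 2 := by
    rw [hℓdef, hTdef, Real.log_mul two_ne_zero hT'pos.ne']; ring
  have hlog2 : 0 < Real.log 2 ∧ Real.log 2 < 1 := ⟨Real.log_pos one_lt_two, by
    rw [Real.log_lt_iff_lt_exp two_pos]; linarith only [he27.1]⟩
  have hlT'0 : 0 ≤ Real.log T' := by rw [hlT']; linarith only [hlog2.2, hℓ4]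
  have hnum : Real.log T' ^ (1 / 3 : ℝ) ≤ u ^ 4 := by
    have h1 : Real.log T' ≤ ℓ := by rw [hlT']; linarith only [hlog2.1]
    calc Real.log T' ^ (1 / 3 : ℝ) ≤ ℓ ^ (1 / 3 : ℝ) := Real.rpow_le_rpow hlT'0 h1 (by norm_num)
      _ = u ^ 4 := by
          rw [← hu12, ← Real.rpow_natCast u 12, ← Real.rpow_mul hu0]; norm_num
  have hden : LL / 2 ≤ Real.log (Real.log T') := by
    have hsqrt : Real.sqrt ℓ ≤ Real.log T' := by
      rw [hlT']
      have h1 : Real.sqrt ℓ ≤ ℓ / 2 := by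
        rw [Real.sqrt_le_iff]
        exact ⟨by positivity, by nlinarith only [hℓ4]⟩
      linarith only [h1, hlog2.2, hℓ4]
    calc LL / 2 = Real.log (Real.sqrt ℓ) := by rw [Real.log_sqrt hℓ0.le, hLLdef]
      _ ≤ Real.log (Real.log T') := Real.log_le_log (Real.sqrt_pos.2 hℓ0) hsqrt
  have hrate : cr / 2 * (Real.log T' ^ (1 / 3 : ℝ) / Real.log (Real.log T')) ≤ M₀ :=
    arith_rate hcrdef hm₀ hcm hupos hLdef hLL0 hm_ge hnum hden
  have hwin : Icc (T / 2) (3 * T) = Icc T' (6 * T') := by rw [hTdef]; congr 1 <;> ring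
  rw [hwin] at hu₁ hu₂
  exact ⟨⟨u₁, hu₁, hrate.trans hS₁⟩, ⟨u₂, hu₂, hS₂.trans (by linarith only [hrate])⟩⟩

/-- **The same from the tree's form of Selberg's density hypothesis** (the shape used in
`SelbergApproxFormulaMeanSquare.approxFormula_meanSquare_of_zeroDensity`): if for some `κ > 0`,
`N(σ, T) ≤ C T^{1 - κ(σ - 1/2)} log T` for `T ≥ T₀` and `1/2 ≤ σ ≤ 1`, then
`S(t) = Ω_±((log t)^{1/3}(log log t)^{-7/3})`. (Shrink `κ` to `min κ 1` and enlarge the constant to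
cover `2 ≤ H < T₀` by monotonicity in `T`.) [cite: Tsang1986, Thm 3 and §3] -/
theorem Selberg1946_zetaArgS_omega_of_zeroDensity'
    (hD : ∃ κ : ℝ, 0 < κ ∧ ∃ C T₀ : ℝ, ∀ T : ℝ, T₀ ≤ T → ∀ σ : ℝ, 1 / 2 ≤ σ → σ ≤ 1 →
      (zetaZeroCountRe σ T : ℝ) ≤ C * T ^ (1 - κ * (σ - 1 / 2)) * Real.log T) :
    Selberg1946_zetaArgS_omega := by
  obtain ⟨κ, hκ, C, T₀, hD⟩ := hD
  set A : ℝ := min κ 1 with hAdef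
  have hA0 : 0 < A := lt_min hκ one_pos
  have hA1 : A ≤ 1 := min_le_right _ _
  have hAκ : A ≤ κ := min_le_left _ _
  set T₁ : ℝ := max T₀ 2 with hT₁def
  have hT₁2 : 2 ≤ T₁ := le_max_right _ _
  have hT₁0 : 0 < T₁ := by linarith
  have hlogT₁ : 0 < Real.log T₁ := Real.log_pos (by linarith)
  set C₁ : ℝ := |C| * T₁ * Real.log T₁ with hC₁def
  have hC₁0 : 0 ≤ C₁ := by positivity
  -- the bound at `T₁` dominates all `H ≤ T₁`
  have hsmall : ∀ σ H : ℝ, 1 / 2 ≤ σ → σ ≤ 1 → H ≤ T₁ → (zetaZeroCountRe σ H : ℝ) ≤ C₁ := by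
    intro σ H h1 h2 hH
    have hmono : zetaZeroCountRe σ H ≤ zetaZeroCountRe σ T₁ := zetaZeroCountRe_mono_right_holds σ hH
    have hexp : T₁ ^ (1 - κ * (σ - 1 / 2)) ≤ T₁ := by
      calc T₁ ^ (1 - κ * (σ - 1 / 2)) ≤ T₁ ^ (1 : ℝ) :=
            Real.rpow_le_rpow_of_exponent_le (by linarith) (by nlinarith)
        _ = T₁ := Real.rpow_one _
    have hX0 : 0 ≤ T₁ ^ (1 - κ * (σ - 1 / 2)) := Real.rpow_nonneg hT₁0.le _
    calc (zetaZeroCountRe σ H : ℝ) ≤ zetaZeroCountRe σ T₁ := by exact_mod_cast hmono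
      _ ≤ C * T₁ ^ (1 - κ * (σ - 1 / 2)) * Real.log T₁ := hD T₁ (le_max_left _ _) σ h1 h2
      _ ≤ |C| * T₁ ^ (1 - κ * (σ - 1 / 2)) * Real.log T₁ :=
          mul_le_mul_of_nonneg_right (mul_le_mul_of_nonneg_right (le_abs_self C) hX0) hlogT₁.le
      _ ≤ |C| * T₁ * Real.log T₁ :=
          mul_le_mul_of_nonneg_right (mul_le_mul_of_nonneg_left hexp (abs_nonneg C)) hlogT₁.le
  refine Selberg1946_zetaArgS_omega_of_zeroDensity (A := A) (B := 1) (Cd := |C| + 2 * C₁) hA0 zero_le_one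
    (by positivity) fun σ H h1 h2 hH ↦ ?_
  have hH0 : 0 < H := by linarith
  have hH1 : 1 ≤ H := by linarith
  have hlogH : Real.log 2 ≤ Real.log H := Real.log_le_log two_pos hH
  have hlog2 : (1 / 2 : ℝ) ≤ Real.log 2 := by
    rw [Real.le_log_iff_exp_le two_pos]
    have h2 : Real.exp (1 / 2) ^ 2 = Real.exp 1 := by rw [← Real.exp_nat_mul]; norm_num
    nlinarith [Real.exp_pos (1 / 2 : ℝ), Real.exp_one_lt_d9]
  have hpow1 : 1 ≤ H ^ (1 - A * (σ - 1 / 2)) := Real.one_le_rpow hH1 (by nlinarith)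
  have hX'0 : 0 ≤ H ^ (1 - A * (σ - 1 / 2)) := le_trans zero_le_one hpow1
  have hlogH0 : 0 ≤ Real.log H := by linarith
  have hCC : |C| ≤ |C| + 2 * C₁ := by linarith
  rw [Real.rpow_one]
  rcases le_or_gt T₁ H with hT | hT
  · -- large `H`: the hypothesis, with the exponent relaxed from `κ` to `A`
    have hexp : H ^ (1 - κ * (σ - 1 / 2)) ≤ H ^ (1 - A * (σ - 1 / 2)) :=
      Real.rpow_le_rpow_of_exponent_le hH1 (by nlinarith)
    have hX0 : 0 ≤ H ^ (1 - κ * (σ - 1 / 2)) := Real.rpow_nonneg hH0.le _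
    calc (zetaZeroCountRe σ H : ℝ) ≤ C * H ^ (1 - κ * (σ - 1 / 2)) * Real.log H :=
          hD H ((le_max_left _ _).trans hT) σ h1 h2
      _ ≤ |C| * H ^ (1 - κ * (σ - 1 / 2)) * Real.log H :=
          mul_le_mul_of_nonneg_right (mul_le_mul_of_nonneg_right (le_abs_self C) hX0) hlogH0
      _ ≤ |C| * H ^ (1 - A * (σ - 1 / 2)) * Real.log H :=
          mul_le_mul_of_nonneg_right (mul_le_mul_of_nonneg_left hexp (abs_nonneg C)) hlogH0
      _ ≤ (|C| + 2 * C₁) * H ^ (1 - A * (σ - 1 / 2)) * Real.log H :=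
          mul_le_mul_of_nonneg_right (mul_le_mul_of_nonneg_right hCC hX'0) hlogH0
  · -- small `H`
    have h := hsmall σ H h1 h2 hT.le
    have hrhs : C₁ ≤ (|C| + 2 * C₁) * H ^ (1 - A * (σ - 1 / 2)) * Real.log H := by
      have h3 : (2 * C₁) * 1 * (1 / 2) ≤ (|C| + 2 * C₁) * H ^ (1 - A * (σ - 1 / 2)) * Real.log H :=
        mul_le_mul (mul_le_mul (by linarith [abs_nonneg C]) hpow1 zero_le_one (by positivity)) (by linarith)
          (by norm_num) (by positivity)
      linarith
    exact h.trans hrhs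

end FinalAssembly

end SelbergOmega

end Literature.NumberTheory.LFunctions

end
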